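import Literature.Geometry.Kaehler.ComplexTorusPicardNumberFirstGap
import Literature.Geometry.Kaehler.ComplexTorusPoincareCompleteReducibilityUniqueness
import Literature.Geometry.Kaehler.ComplexTorusPoincareCompleteReducibilityPowers
import Literature.Geometry.Kaehler.ComplexTorusQuotientAbelianVariety
import HarnessLib

/-!
# The Picard number along a Poincaré decomposition `A ∼ X₁^{n₁} × ⋯ × X_r^{n_r}`:
# Hulek–Laface 2019, Cor. 2.3 as printed, Prop. 3.1 (`ρ(A) ≤ M_{r(A),g} = [g − (r−1)]² + (r−1)`),
# Cor. 3.2 (the extremal case) and Thm. 1.1 (1) outside Murty's case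

Layer `Literature/Geometry/Kaehler`, namespace `Literature.Geometry.Kaehler.ComplexTorus`; lane
`lit-hodgefound` (Track 2 foundations library), Layer A4 row A4-13 / A2-26(k) (self-proposed 2026-08-22,
seat `lit-hodgefound-p18`, generation 6). Fourth file of the lineage
`ComplexTorusPicardNumberProduct.lean` (two factors: `NS_ℚ(X₁ × X₂) = NS_ℚ(X₁) ⊕ NS_ℚ(X₂) ⊕ Hom_ℚ(X₂, X̂₁)`,
`IsAbelianVariety.finrank_neronSeveriGroup_prod'`) → `ComplexTorusPicardNumberFiniteProduct.lean`
(`n` factors on ONE ambient space, `piPeriod`) → `ComplexTorusPicardNumberFirstGap.lean` (Thm. 1.1 (1) for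
elliptic products).  Here the factors have ARBITRARY dimensions: the products are the dependent finite
products `∏_k X_k = ComplexTorus (sigmaPiPeriod Ψ)` of `ComplexTorusPoincareCompleteReducibilityIsogeny.lean`
(seat p10), and an abelian variety is followed along a POINCARÉ DECOMPOSITION
`A ∼ ∏_ν X_ν^{n_ν} = ComplexTorus (sigmaPiPeriod fun ν ↦ powPeriod (X ν) (n ν))` with simple, nonzero,
pairwise non-isogenous abelian varieties `X_ν` and `n_ν ≥ 1` — which exists
(`poincare_complete_reducibility_powers`, `ComplexTorusPoincareCompleteReducibilityPowers.lean`) and whose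
length `r` and factors are unique (`poincare_complete_reducibility_unique_powers`,
`card_eq_of_isIsogenous_powers`, `ComplexTorusPoincareCompleteReducibilityUniqueness.lean`).  This renders
Hulek–Laface's invariant `r(A)` ("the length of a decomposition according to Poincaré Complete
Reducibility Theorem") without a new definition: every statement below is made for an arbitrary such
decomposition, and by uniqueness it does not depend on the choice.

Source followed, verbatim (K. Hulek, R. Laface, *On the Picard numbers of abelian varieties*, Ann. Sc.
Norm. Super. Pisa Cl. Sci. (5) XIX (2019); held text `paper:arxiv-1703.05882` p0002, p0005–p0007):
"**Corollary 2.3.** Let `A_1, …, A_r` be simple abelian varieties, such that `A_i` is not isogenous to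
`A_j` for `i ≠ j`. Then, `ρ(∏_{i=1}^r A_i^{n_i}) = Σ_{i=1}^r ρ(A_i^{n_i})`." — "letting `A` be an abelian
variety, we define `r(A)` to be the length of a decomposition according to Poincaré Complete Reducibility
Theorem […] `M_{r,g} := max{ρ(A) ∣ dim A = g, r(A) = r}`. **Proposition 3.1.** For integers `r, g ∈ ℕ`
such that `r ≤ g`, one has `M_{r,g} = [g − (r−1)]² + (r−1)`. This value is attained as the Picard number
of `E^{g−r+1} × E_1 × ⋯ × E_{r−1}` […] *Proof.* If `A ∼ A_1 × ⋯ × A_r`, `Hom(A_i, A_j) = 0` for `i ≠ j`, then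
`ρ(A) ≤ k_1² + ⋯ + k_r²` where `k_i := dim A_i` […] we are looking for the maxima of the function
`h(x_1, …, x_r) = x_1² + ⋯ + x_r²` on the integral points of the simplex `Ω_{r,g}` […] These points are
precisely the vertices `(g−r+1, 1, …, 1), …` […] Therefore, we conclude that `ρ(A) ≤ [g−(r−1)]² + (r−1)`."
— "**Corollary 3.2.** Let `A` be an abelian variety. Then, `ρ(A) = M_{r(A),g} ⟺ A ∼ E^{g−(r−1)} × E_1 ×
⋯ × E_{r−1}`, where `E` is a CM elliptic curve not isogenous to any of the `E_i`'s, and `E_i` and `E_j`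
are not isogenous for `i ≠ j`." — "**Remark 3.3.** The numbers `M_{r,g}` give the following (strictly)
increasing sequence of positive integers: `g = M_{g,g} < M_{g−1,g} < ⋯ < M_{2,g} < M_{1,g} = g²`." —
"**Theorem 1.1.** (1) Fix `g ≥ 4`. There does not exist any abelian variety of dimension `g` with Picard
number `ρ` in the following range: `(g−1)² + 1 < ρ < g²`." with its proof §3.2: "(a) Since `r(A) ≥ 2`, we
have that `A ∼ A_1 × A_2` with `Hom(A_1,A_2) = 0` […] Therefore, `ρ(A) ≤ (g−1)² + 1`. (b) Let `B` be an
`m`-dimensional simple abelian variety, and suppose `A` is isogenous to `B^k` […] If `m = 1` […]".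

## Contents (theorems only; no definition, no named fact, net debt 0)

* §1 splitting finite products of tori of arbitrary dimensions (all by `isIsomorphic_of_reindex`):
  **`isIsomorphic_sigmaPiPeriod_sumEquiv`** (`∏_k X_k ≅ (∏_{κ₁} X) × (∏_{κ₂} X)` along `κ ≃ κ₁ ⊕ κ₂`),
  `isIsomorphic_sigmaPiPeriod_unique` (one factor), `isIsomorphic_sigmaPiPeriod_compEquiv` (relabelling),
  **`isIsomorphic_sigmaPiPeriod_succ`** (`∏_{k≤n} X_k ≅ (∏_{k<n} X_k) × X_n`).
* §2 **`finrank_homRat_sigmaPiPeriod_left`** (`dim_ℚ Hom_ℚ(∏_k X_k, Y) = Σ_k dim_ℚ Hom_ℚ(X_k, Y)` for every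
  torus — the left companion of p10's `finrank_homRat_sigmaPiPeriod_right`), `…_left_fin`.
* §3 **`finrank_neronSeveriGroup_sigmaPi`** — for abelian varieties `X₀, …, X_{n−1}` of arbitrary dimensions
  `ρ(∏ X_k) = Σ_k ρ(X_k) + Σ_{k<l} dim_ℚ Hom_ℚ(X_k, X_l)`;
  `finrank_neronSeveriGroup_sum_le_sigmaPi`, Cor. 2.3 for pairwise `Hom`-orthogonal factors
  `finrank_neronSeveriGroup_sigmaPi_eq_sum_of_pairwise`, Prop. 3.1 (proof)
  `finrank_neronSeveriGroup_sigmaPi_le_sum_sq` and its isogeny-class form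
  `IsIsogenous.finrank_neronSeveriGroup_le_sum_sq` (`ρ(A) ≤ Σ k_i²`).
* §4 arbitrary finite index sets (`…_of_forall_ne`) and **Cor. 2.3 AS PRINTED
  `finrank_neronSeveriGroup_powers`**: `ρ(∏_ν X_ν^{n_ν}) = Σ_ν ρ(X_ν^{n_ν})` for simple pairwise non-isogenous
  abelian varieties `X_ν` (`homRat_powPeriod_eq_bot_of_ne`: "`Hom(X_ν^{n_ν}, X_μ^{n_μ}) = 0` for `ν ≠ μ`").
* §5 the simplex maximisation: **`sum_sq_le_sq_sub_add`** (`k_ν ≥ 1 ⟹ Σ k_ν² ≤ [Σ k_ν − (r−1)]² + (r−1)`),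
  its equality case **`eq_one_or_eq_one_of_sq_sub_add_le`** (at most one `k_ν > 1` — "precisely the
  vertices") and the vertex value `sum_eq_add_card_sub_one_of_forall_ne`.
* §6 **Prop. 3.1: `finrank_neronSeveriGroup_powers_le`** (`ρ(∏_ν X_ν^{n_ν}) ≤ [g − (r−1)]² + (r−1)`,
  `g = Σ_ν n_ν dim X_ν` = `finrank_powers_eq`) and **`IsIsogenous.finrank_neronSeveriGroup_le_of_powers`**
  ("`ρ(A) ≤ M_{r(A),g}`" for every `A` with a Poincaré decomposition of length `r`); Remark 3.3
  `sq_sub_add_lt_sq_sub_add` (`M_{r',g} < M_{r,g}` for `r < r' ≤ g`), `sq_sub_add_self_and_one`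
  (`M_{g,g} = g`, `M_{1,g} = g²`); Thm. 1.1 (1) case (a) for EVERY abelian variety
  **`IsIsogenous.finrank_neronSeveriGroup_le_sq_pred_add_one_of_two_le_card`** (`r(A) ≥ 2 ⟹ ρ(A) ≤ (g−1)²+1`).
  (Prop. 3.1's "this value is attained" is `exists_pi_ellipticPeriod_finrank_neronSeveriGroup_eq` of
  `ComplexTorusPicardNumberFiniteProduct.lean`.)
* §7 **Cor. 3.2: `finrank_neronSeveriGroup_powers_eq_iff`** — `ρ(∏_ν X_ν^{n_ν}) = [g − (r−1)]² + (r−1)` iff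
  for some `ν₀` every `X_ν` is an elliptic curve (`dim X_ν = 1`), `n_ν = 1` for `ν ≠ ν₀`, and `X_{ν₀}` has
  complex multiplication (`dim_ℚ End_ℚ(X_{ν₀}) = 2`) whenever `n_{ν₀} = g − (r−1) ≥ 2`; the isogeny-class form
  `IsIsogenous.finrank_neronSeveriGroup_eq_iff_of_powers`; the printed shape
  **`exists_isIsogenous_cm_ellipticPow_prod_of_finrank_neronSeveriGroup_eq`**
  (`∏_ν X_ν^{n_ν} ∼ E_θ^{g−(r−1)} × ∏_{ν≠ν₀} X_ν`, `E_θ` CM, `X_ν ≁ E_θ` elliptic) and the Poincaré-uniqueness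
  lemma `IsSimple.isIsogenous_ellipticPeriod_of_pow` (`X` simple, `Xⁿ ∼ E_θᵏ ⟹ X ∼ E_θ ∧ n = k`).
  RECORDED SCOPE of Cor. 3.2: for `r(A) = g` (all `n_ν dim X_ν = 1`, `M_{g,g} = g`) the printed clause "`E` is a
  CM elliptic curve" is not forced — every product of `g` pairwise non-isogenous elliptic curves has `ρ = g`
  (`finrank_neronSeveriGroup_pi_ellipticPeriod_of_pairwise_not_isIsogenous`); accordingly the CM clause is
  stated (and proved necessary) exactly when the exponent `g − (r−1)` is `≥ 2`, and the `⟸` direction holds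
  for all `r`.
* §8 **Thm. 1.1 (1) for every abelian variety outside Murty's case**:
  `IsIsogenous.finrank_neronSeveriGroup_eq_sq_or_le_of_powers`,
  **`IsIsogenous.not_lt_finrank_neronSeveriGroup_lt_of_powers`** — `g ≥ 4` and the Poincaré decomposition of
  `A` is not `Bᵏ` with ONE simple `B` of dimension `≥ 2` ⟹ `ρ(A) ∉ ((g−1)²+1, g²)`. The excluded case needs
  Murty's `ρ(Bᵏ)` by Albert type (Prop. 2.4 / Cor. 2.5), not in the tree — `TODO(general form)`.
* §10 (add-only sequel) **the factors of a Poincaré decomposition of an abelian variety are abelian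
  varieties**: `IsAbelianVariety.of_sigmaPi` / `isAbelianVariety_sigmaPi_iff` (a factor of an abelian finite
  product torus is abelian — Swinnerton-Dyer's Thm. 34 Cor. 1 `IsAbelianVariety.of_prod_left` along the
  two-block split), `IsAbelianVariety.of_pow` / `isAbelianVariety_powPeriod_iff`, and
  **`IsAbelianVariety.of_isIsogenous_powers`** (`A` abelian, `A ∼ ∏_ν X_ν^{n_ν}`, `n_ν ≥ 1` ⟹ every `X_ν` is an
  abelian variety) — so the hypothesis "`X_ν` abelian varieties" of the statements above is automatic for a
  decomposition of an abelian variety.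
* §9 validation `finrank_neronSeveriGroup_ellipticSqrt_sq_prod_ellipticSqrt`
  (`ρ(E_{i√m}² × E_{i√m'}) = 5 = M_{2,3}` for `m m'` not a square, e.g. `E_{i√2}² × E_{i√3}`), computed
  through Cor. 2.3 as printed.

## References

* [HulekLaface2019PicardNumbersAV] K. Hulek, R. Laface, *On the Picard numbers of abelian varieties*,
  Ann. Sc. Norm. Super. Pisa Cl. Sci. (5) XIX (2019) 1199–1224 (arXiv:1703.05882), §1 Thm. 1.1, §2.1
  Prop. 2.2, Cor. 2.3, §2.2 Prop. 2.4 / Cor. 2.5 (Murty), §3.1 Prop. 3.1, Cor. 3.2, Rem. 3.3, §3.2.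
* [Lange2023AbelianVarietiesComplex] H. Lange, *Abelian Varieties over the Complex Numbers*, Grundlehren
  Text Edition, Springer (2023), §1.1.1–§1.1.2 (products, Lemma 1.1.11, Cor. 1.1.16), §1.3.1 Exercise
  1.3.4 (10)(b) (`ρ ≤ g²`), §2.4.4 Thm. 2.4.25 and Cor. 2.4.26 (Poincaré's complete reducibility,
  `Hom(X_ν^{n_ν}, X_μ^{n_μ}) = 0`), §7.3.3 Exercise (3) (`ρ(E_τⁿ)`).
* [MumfordAV1970] D. Mumford, *Abelian Varieties* (1970), §19 Thm. 1, Cor. 1 and Cor. 2 (uniqueness of the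
  decomposition up to isogeny).
* [SwinnertonDyer1974AbelianVarieties] H. P. F. Swinnerton-Dyer, *Analytic Theory of Abelian Varieties*
  (1974), Ch. II §7 Thm. 34 Cor. 1 (a factor of an abelian product torus is abelian).
-/

noncomputable section

set_option maxSynthPendingDepth 3

open Module Matrix Function
open Complex (I)

namespace Literature.Geometry.Kaehler

namespace ComplexTorus

/-! ## §1 Splitting a finite product of complex tori of different dimensions -/

section Split

variable {κ : Type*} [Fintype κ] [DecidableEq κ] {σ : κ → Type*} [∀ k, Fintype (σ k)]
  [∀ k, DecidableEq (σ k)] {F : κ → Type*} [∀ k, NormedAddCommGroup (F k)] [∀ k, NormedSpace ℂ (F k)]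
  (Ψ : ∀ k, (σ k → ℝ) ≃L[ℝ] F k)
  {κ₁ κ₂ : Type*} [Fintype κ₁] [Fintype κ₂] [DecidableEq κ₁] [DecidableEq κ₂]

/-- **Splitting a finite product of tori into two blocks along a partition of the index set**:
for `e : κ ≃ κ₁ ⊕ κ₂`, `∏_{k ∈ κ} X_k ≅ (∏_{i ∈ κ₁} X_{e⁻¹(i)}) × (∏_{j ∈ κ₂} X_{e⁻¹(j)})` as complex tori
(a reindexing of the concatenated lattice bases; the binary product is `prodPeriod`, the finite products are
the dependent products `sigmaPiPeriod`).
[cite: Lange2023AbelianVarietiesComplex, §2.4.4 Thm. 2.4.25 (the product `X₁^{n₁} × ⋯ × X_r^{n_r}`), p. 123]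
[cite: HulekLaface2019PicardNumbersAV, §3.2 (a) ("`A ∼ A_1 × A_2` with `Hom(A_1,A_2) = 0`")] -/
theorem isIsomorphic_sigmaPiPeriod_sumEquiv (e : κ ≃ κ₁ ⊕ κ₂) :
    IsIsomorphic (sigmaPiPeriod Ψ)
      (prodPeriod (sigmaPiPeriod fun i : κ₁ ↦ Ψ (e.symm (Sum.inl i)))
        (sigmaPiPeriod fun j : κ₂ ↦ Ψ (e.symm (Sum.inr j)))) :=
  isIsomorphic_of_reindex _ _
    ((Equiv.sigmaCongrLeft (β := σ) e.symm).symm.trans (Equiv.sumSigmaDistrib fun k' ↦ σ (e.symm k')))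
    ((ContinuousLinearMap.pi fun i : κ₁ ↦
        ContinuousLinearMap.proj (R := ℂ) (φ := F) (e.symm (Sum.inl i))).prod
      (ContinuousLinearMap.pi fun j : κ₂ ↦
        ContinuousLinearMap.proj (R := ℂ) (φ := F) (e.symm (Sum.inr j))))
    fun _ ↦ rfl

/-- **A product with a single factor is that factor**: for a `Unique` index set,
`∏_{k} X_k ≅ X_{default}`. [cite: Lange2023AbelianVarietiesComplex, §2.4.4 Thm. 2.4.25 (the product `X₁^{n₁} × ⋯ × X_r^{n_r}`), p. 123] -/
theorem isIsomorphic_sigmaPiPeriod_unique {κ : Type*} [Fintype κ] [Unique κ] {σ : κ → Type*} [∀ k, Fintype (σ k)]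
    [∀ k, DecidableEq (σ k)] {F : κ → Type*} [∀ k, NormedAddCommGroup (F k)] [∀ k, NormedSpace ℂ (F k)]
    (Ψ : ∀ k, (σ k → ℝ) ≃L[ℝ] F k) : IsIsomorphic (sigmaPiPeriod Ψ) (Ψ default) :=
  isIsomorphic_of_reindex _ _ (Equiv.uniqueSigma σ)
    (ContinuousLinearMap.proj (R := ℂ) (φ := F) default) fun _ ↦ rfl

/-- **Relabelling the factors along a bijection of the index sets is an isomorphism**:
`∏_{k' ∈ κ'} X_{k'} ≅ ∏_{k ∈ κ} X_{e k}` for `e : κ ≃ κ'` ("up to permutations" in Thm. 2.4.25).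
[cite: Lange2023AbelianVarietiesComplex, §2.4.4 Thm. 2.4.25 ("uniquely determined up to isogenies and permutations"), p. 123] -/
theorem isIsomorphic_sigmaPiPeriod_compEquiv {κ' : Type*} [Fintype κ'] [DecidableEq κ'] {σ' : κ' → Type*}
    [∀ k, Fintype (σ' k)] [∀ k, DecidableEq (σ' k)] {F' : κ' → Type*} [∀ k, NormedAddCommGroup (F' k)]
    [∀ k, NormedSpace ℂ (F' k)] (Ψ' : ∀ k, (σ' k → ℝ) ≃L[ℝ] F' k) (e : κ ≃ κ') :
    IsIsomorphic (sigmaPiPeriod Ψ') (sigmaPiPeriod fun k ↦ Ψ' (e k)) :=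
  isIsomorphic_of_reindex _ _ (Equiv.sigmaCongrLeft (β := σ') e).symm
    (ContinuousLinearMap.pi fun k : κ ↦ ContinuousLinearMap.proj (R := ℂ) (φ := F') (e k))
    fun _ ↦ funext fun _ ↦ rfl

variable {n : ℕ} {σ' : Fin (n + 1) → Type*} [∀ k, Fintype (σ' k)] [∀ k, DecidableEq (σ' k)]
  {F' : Fin (n + 1) → Type*} [∀ k, NormedAddCommGroup (F' k)] [∀ k, NormedSpace ℂ (F' k)]
  (Ξ : ∀ k, (σ' k → ℝ) ≃L[ℝ] F' k)

/-- **`X₀ × ⋯ × X_n ≅ (X₀ × ⋯ × X_{n−1}) × X_n`** for tori of arbitrary dimensions: splitting off the last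
factor of a finite (dependent) product torus is an isomorphism of complex tori (for a family on one
ambient space cf. `isIsomorphic_piPeriod_succ`). [cite: Lange2023AbelianVarietiesComplex, §2.4.4 Thm. 2.4.25 (the product `X₁^{n₁} × ⋯ × X_r^{n_r}`), p. 123] -/
theorem isIsomorphic_sigmaPiPeriod_succ :
    IsIsomorphic (sigmaPiPeriod Ξ)
      (prodPeriod (sigmaPiPeriod fun k : Fin n ↦ Ξ k.castSucc) (Ξ (Fin.last n))) := by
  let idx : (Σ k : Fin (n + 1), σ' k) ≃ (Σ k : Fin n, σ' k.castSucc) ⊕ σ' (Fin.last n) :=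
    { toFun := fun p ↦ Fin.lastCases
          (motive := fun k ↦ σ' k → (Σ k : Fin n, σ' k.castSucc) ⊕ σ' (Fin.last n))
          Sum.inr (fun k a ↦ Sum.inl ⟨k, a⟩) p.1 p.2
      invFun := Sum.elim (fun q ↦ ⟨q.1.castSucc, q.2⟩) (fun a ↦ ⟨Fin.last n, a⟩)
      left_inv := by
        rintro ⟨k, a⟩
        induction k using Fin.lastCases with
        | last => simp only [Fin.lastCases_last, Sum.elim_inr]
        | cast k => simp only [Fin.lastCases_castSucc, Sum.elim_inl]
      right_inv := by
        rintro (⟨k, a⟩ | a)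
        · simp only [Sum.elim_inl, Fin.lastCases_castSucc]
        · simp only [Sum.elim_inr, Fin.lastCases_last] }
  refine isIsomorphic_of_reindex _ _ idx
    ((ContinuousLinearMap.pi fun k : Fin n ↦
        ContinuousLinearMap.proj (R := ℂ) (φ := F') k.castSucc).prod
      (ContinuousLinearMap.proj (R := ℂ) (φ := F') (Fin.last n)))
    fun _ ↦ rfl

end Split

/-! ## §2 `Hom_ℚ(∏_k X_k, Y) = ⊕_k Hom_ℚ(X_k, Y)` (the left companion of `finrank_homRat_sigmaPiPeriod_right`) -/

section HomLeft

variable {ι₀ : Type*} [Fintype ι₀] [DecidableEq ι₀] {E₀ : Type*} [NormedAddCommGroup E₀] [NormedSpace ℂ E₀]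
  (Y : (ι₀ → ℝ) ≃L[ℝ] E₀)
  {κ : Type*} [Fintype κ] [DecidableEq κ] {σ : κ → Type*} [∀ k, Fintype (σ k)] [∀ k, DecidableEq (σ k)]
  {F : κ → Type*} [∀ k, NormedAddCommGroup (F k)] [∀ k, NormedSpace ℂ (F k)]
  (Ψ : ∀ k, (σ k → ℝ) ≃L[ℝ] F k)

/-- **`dim_ℚ Hom_ℚ(∏_k X_k, Y) = Σ_k dim_ℚ Hom_ℚ(X_k, Y)`** for complex tori `X_k` of arbitrary dimensions
and any complex torus `Y` (a homomorphism out of a product is the family of its restrictions to the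
factors) — proved by induction on the number of factors along `∏_{k≤n} X_k ≅ (∏_{k<n} X_k) × X_n`
(`isIsomorphic_sigmaPiPeriod_succ`, `finrank_homRat_prod_left`, isogeny invariance of `dim_ℚ Hom_ℚ`).
[cite: Lange2023AbelianVarietiesComplex, §2.4.4 Cor. 2.4.26 (proof: `Hom` of products blockwise), p. 124] -/
theorem finrank_homRat_sigmaPiPeriod_left_fin :
    ∀ {n : ℕ} {σ : Fin n → Type*} [∀ k, Fintype (σ k)] [∀ k, DecidableEq (σ k)] {F : Fin n → Type*}
      [∀ k, NormedAddCommGroup (F k)] [∀ k, NormedSpace ℂ (F k)] (Ψ : ∀ k, (σ k → ℝ) ≃L[ℝ] F k),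
      finrank ℚ (homRat (sigmaPiPeriod Ψ) Y) = ∑ k, finrank ℚ (homRat (Ψ k) Y)
  | 0, σ, _, _, F, _, _, Ψ => by
    rw [Finset.univ_eq_empty, Finset.sum_empty]
    haveI : IsEmpty (Σ k : Fin 0, σ k) := by infer_instance
    exact finrank_zero_of_subsingleton
  | n + 1, σ, _, _, F, _, _, Ψ => by
    rw [(isIsomorphic_sigmaPiPeriod_succ Ψ).isIsogenous.finrank_homRat_eq_left Y, finrank_homRat_prod_left,
      finrank_homRat_sigmaPiPeriod_left_fin (fun k : Fin n ↦ Ψ k.castSucc),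
      Fin.sum_univ_castSucc (fun k ↦ finrank ℚ (homRat (Ψ k) Y))]

/-- **`dim_ℚ Hom_ℚ(∏_k X_k, Y) = Σ_k dim_ℚ Hom_ℚ(X_k, Y)`** over any finite index type (relabel the
factors along `Fin |κ| ≃ κ`, `isIsomorphic_sigmaPiPeriod_compEquiv`).
[cite: Lange2023AbelianVarietiesComplex, §2.4.4 Cor. 2.4.26 (proof: `Hom` of products blockwise), p. 124] -/
theorem finrank_homRat_sigmaPiPeriod_left :
    finrank ℚ (homRat (sigmaPiPeriod Ψ) Y) = ∑ k, finrank ℚ (homRat (Ψ k) Y) := by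
  classical
  let e : Fin (Fintype.card κ) ≃ κ := (Fintype.equivFin κ).symm
  rw [(isIsomorphic_sigmaPiPeriod_compEquiv Ψ e).isIsogenous.finrank_homRat_eq_left Y,
    finrank_homRat_sigmaPiPeriod_left_fin Y (fun k ↦ Ψ (e k))]
  exact Fintype.sum_equiv e _ _ fun _ ↦ rfl

end HomLeft

/-! ## §3 The Picard number of a finite product of abelian varieties of arbitrary dimensions -/

section Pi

/-- The cross sum splits off its last column: `Σ_{k<l≤n} h(k,l) = Σ_{k<l<n} h(k,l) + Σ_{k<n} h(k,n)`. [folklore] -/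
private theorem sum_sum_ite_lt_succ {n : ℕ} (h : Fin (n + 1) → Fin (n + 1) → ℕ) :
    (∑ l : Fin (n + 1), ∑ k : Fin (n + 1), if k < l then h k l else 0) =
      (∑ l : Fin n, ∑ k : Fin n, if k < l then h k.castSucc l.castSucc else 0) +
        ∑ k : Fin n, h k.castSucc (Fin.last n) := by
  rw [Fin.sum_univ_castSucc]
  congr 1
  · refine Finset.sum_congr rfl fun l _ ↦ ?_
    rw [Fin.sum_univ_castSucc, if_neg (lt_asymm (Fin.castSucc_lt_last l)), Nat.add_zero]
    refine Finset.sum_congr rfl fun k _ ↦ ?_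
    simp only [Fin.castSucc_lt_castSucc_iff]
  · rw [Fin.sum_univ_castSucc, if_neg (lt_irrefl _), Nat.add_zero]
    refine Finset.sum_congr rfl fun k _ ↦ ?_
    rw [if_pos (Fin.castSucc_lt_last k)]

/-- The product of an empty family of tori is a point: `ρ(∏_{k<0} X_k) = 0`. [folklore] -/
private theorem finrank_neronSeveriGroup_sigmaPi_zero {σ : Fin 0 → Type*} [∀ k, Fintype (σ k)]
    [∀ k, DecidableEq (σ k)] {F : Fin 0 → Type*} [∀ k, NormedAddCommGroup (F k)] [∀ k, NormedSpace ℂ (F k)]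
    (Ψ : ∀ k, (σ k → ℝ) ≃L[ℝ] F k) : finrank ℤ (neronSeveriGroup (sigmaPiPeriod Ψ)) = 0 := by
  have h := finrank_neronSeveriGroup_le_sq (sigmaPiPeriod Ψ)
  have h0 : finrank ℂ (∀ k : Fin 0, F k) = 0 := finrank_zero_of_subsingleton
  rw [h0] at h
  exact Nat.le_zero.1 (by simpa using h)

/-- **The Picard number of a finite product of abelian varieties of arbitrary dimensions** ("This,
together with Murty's result, provides us with a theoretical algorithm for computing the Picard number
of a given abelian variety"): for abelian varieties `X₀, …, X_{n−1}` (complex tori `X_k = F_k/Ψ_k(ℤ^{σ_k})`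
with a polarisation, of any dimensions),
`ρ(X₀ × ⋯ × X_{n−1}) = Σ_k ρ(X_k) + Σ_{k<l} dim_ℚ Hom_ℚ(X_k, X_l)` — Hulek–Laface's Prop. 2.2 / Cor. 2.3
for two factors (`IsAbelianVariety.finrank_neronSeveriGroup_prod'`) iterated along
`∏_{k≤n} X_k ≅ (∏_{k<n} X_k) × X_n`; the homogeneous case (one ambient space) is `finrank_neronSeveriGroup_pi`.
[cite: HulekLaface2019PicardNumbersAV, §2.1 Prop. 2.2 and Cor. 2.3; §1 ("theoretical algorithm")] -/
theorem finrank_neronSeveriGroup_sigmaPi :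
    ∀ {n : ℕ} {σ : Fin n → Type*} [∀ k, Fintype (σ k)] [∀ k, DecidableEq (σ k)] {F : Fin n → Type*}
      [∀ k, NormedAddCommGroup (F k)] [∀ k, NormedSpace ℂ (F k)] (Ψ : ∀ k, (σ k → ℝ) ≃L[ℝ] F k)
      (_ : ∀ k, IsAbelianVariety (Ψ k)),
      finrank ℤ (neronSeveriGroup (sigmaPiPeriod Ψ)) =
        (∑ k, finrank ℤ (neronSeveriGroup (Ψ k))) +
          ∑ l, ∑ k, if k < l then finrank ℚ (homRat (Ψ k) (Ψ l)) else 0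
  | 0, σ, _, _, F, _, _, Ψ, _ => by
    rw [finrank_neronSeveriGroup_sigmaPi_zero, Finset.univ_eq_empty, Finset.sum_empty, Finset.sum_empty,
      Nat.add_zero]
  | n + 1, σ, _, _, F, _, _, Ψ, hA => by
    rw [(isIsomorphic_sigmaPiPeriod_succ Ψ).isIsogenous.finrank_neronSeveriGroup_eq _ _,
      (hA (Fin.last n)).finrank_neronSeveriGroup_prod' (sigmaPiPeriod fun k : Fin n ↦ Ψ k.castSucc),
      finrank_neronSeveriGroup_sigmaPi (fun k : Fin n ↦ Ψ k.castSucc) (fun k ↦ hA k.castSucc),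
      finrank_homRat_sigmaPiPeriod_left_fin (Ψ (Fin.last n)) (fun k : Fin n ↦ Ψ k.castSucc),
      sum_sum_ite_lt_succ (fun k l ↦ finrank ℚ (homRat (Ψ k) (Ψ l))),
      Fin.sum_univ_castSucc (fun k ↦ finrank ℤ (neronSeveriGroup (Ψ k)))]
    ring

variable {n : ℕ} {σ : Fin n → Type*} [∀ k, Fintype (σ k)] [∀ k, DecidableEq (σ k)] {F : Fin n → Type*}
  [∀ k, NormedAddCommGroup (F k)] [∀ k, NormedSpace ℂ (F k)] (Ψ : ∀ k, (σ k → ℝ) ≃L[ℝ] F k)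

/-- `Σ_k ρ(X_k) ≤ ρ(∏_k X_k)` for abelian varieties ("exterior pull-back of line bundles always yields an
injective map"). [cite: HulekLaface2019PicardNumbersAV, §2.1 (after Prop. 2.2)] -/
theorem finrank_neronSeveriGroup_sum_le_sigmaPi (hA : ∀ k, IsAbelianVariety (Ψ k)) :
    ∑ k, finrank ℤ (neronSeveriGroup (Ψ k)) ≤ finrank ℤ (neronSeveriGroup (sigmaPiPeriod Ψ)) := by
  rw [finrank_neronSeveriGroup_sigmaPi Ψ hA]
  exact Nat.le_add_right _ _

/-- **Hulek–Laface 2019, Cor. 2.3 (additivity for pairwise `Hom`-orthogonal factors of arbitrary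
dimensions): if `Hom(X_k, X_l) = 0` for all `k < l` then `ρ(X₀ × ⋯ × X_{n−1}) = Σ_k ρ(X_k)`** ("the Picard
number is additive (but not strongly additive) for product varieties coming from the Poincaré's Complete
Reducibility Theorem"). [cite: HulekLaface2019PicardNumbersAV, §2.1 Cor. 2.3] -/
theorem finrank_neronSeveriGroup_sigmaPi_eq_sum_of_pairwise (hA : ∀ k, IsAbelianVariety (Ψ k))
    (h : ∀ k l, k < l → homRat (Ψ k) (Ψ l) = ⊥) :
    finrank ℤ (neronSeveriGroup (sigmaPiPeriod Ψ)) = ∑ k, finrank ℤ (neronSeveriGroup (Ψ k)) := by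
  rw [finrank_neronSeveriGroup_sigmaPi Ψ hA, Nat.add_eq_left]
  refine Finset.sum_eq_zero fun l _ ↦ Finset.sum_eq_zero fun k _ ↦ ?_
  split_ifs with hkl
  · rw [h k l hkl, finrank_bot]
  · rfl

/-- **Hulek–Laface 2019, Prop. 3.1 (proof): "If `A ∼ A_1 × ⋯ × A_r`, `Hom(A_i, A_j) = 0` for `i ≠ j`, then
`ρ(A) ≤ k_1² + ⋯ + k_r²` where `k_i := dim A_i`"** — the product itself, factors of arbitrary dimensions
`k_i = dim_ℂ F_i` (`ρ(X_k) ≤ (dim X_k)²`, Exercise 1.3.4 (10)(b)). [cite: HulekLaface2019PicardNumbersAV, §3.1 Prop. 3.1 (proof)] -/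
theorem finrank_neronSeveriGroup_sigmaPi_le_sum_sq (hA : ∀ k, IsAbelianVariety (Ψ k))
    (h : ∀ k l, k < l → homRat (Ψ k) (Ψ l) = ⊥) :
    finrank ℤ (neronSeveriGroup (sigmaPiPeriod Ψ)) ≤ ∑ k, finrank ℂ (F k) ^ 2 := by
  rw [finrank_neronSeveriGroup_sigmaPi_eq_sum_of_pairwise Ψ hA h]
  exact Finset.sum_le_sum fun k _ ↦ finrank_neronSeveriGroup_le_sq (Ψ k)

/-- **Prop. 3.1 (proof), as printed: `A ∼ X₀ × ⋯ × X_{n−1}` with pairwise `Hom(X_k, X_l) = 0` ⟹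
`ρ(A) ≤ Σ_k (dim X_k)²`** (`ρ` is an isogeny invariant). [cite: HulekLaface2019PicardNumbersAV, §3.1 Prop. 3.1 (proof)] -/
theorem IsIsogenous.finrank_neronSeveriGroup_le_sum_sq {ι' : Type*} [Fintype ι'] [DecidableEq ι']
    {E' : Type*} [NormedAddCommGroup E'] [NormedSpace ℂ E'] {A : (ι' → ℝ) ≃L[ℝ] E'}
    (hiso : IsIsogenous A (sigmaPiPeriod Ψ)) (hA : ∀ k, IsAbelianVariety (Ψ k))
    (h : ∀ k l, k < l → homRat (Ψ k) (Ψ l) = ⊥) :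
    finrank ℤ (neronSeveriGroup A) ≤ ∑ k, finrank ℂ (F k) ^ 2 := by
  rw [hiso.finrank_neronSeveriGroup_eq A (sigmaPiPeriod Ψ)]
  exact finrank_neronSeveriGroup_sigmaPi_le_sum_sq Ψ hA h

end Pi

/-! ## §4 Arbitrary finite index sets and Cor. 2.3 as printed: `ρ(∏_ν X_ν^{n_ν}) = Σ_ν ρ(X_ν^{n_ν})` -/

section Powers

variable {κ : Type*} [Fintype κ] [DecidableEq κ] {σ : κ → Type*} [∀ k, Fintype (σ k)]
  [∀ k, DecidableEq (σ k)] {F : κ → Type*} [∀ k, NormedAddCommGroup (F k)] [∀ k, NormedSpace ℂ (F k)]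
  (Ψ : ∀ k, (σ k → ℝ) ≃L[ℝ] F k)

/-- **Cor. 2.3 over an arbitrary finite index set**: if `Hom(X_k, X_l) = 0` for all `k ≠ l` then
`ρ(∏_k X_k) = Σ_k ρ(X_k)` for abelian varieties `X_k` of arbitrary dimensions.
[cite: HulekLaface2019PicardNumbersAV, §2.1 Cor. 2.3] -/
theorem finrank_neronSeveriGroup_sigmaPi_eq_sum_of_forall_ne (hA : ∀ k, IsAbelianVariety (Ψ k))
    (h : ∀ k l, k ≠ l → homRat (Ψ k) (Ψ l) = ⊥) :
    finrank ℤ (neronSeveriGroup (sigmaPiPeriod Ψ)) = ∑ k, finrank ℤ (neronSeveriGroup (Ψ k)) := by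
  classical
  let e : Fin (Fintype.card κ) ≃ κ := (Fintype.equivFin κ).symm
  rw [(isIsomorphic_sigmaPiPeriod_compEquiv Ψ e).isIsogenous.finrank_neronSeveriGroup_eq _ _,
    finrank_neronSeveriGroup_sigmaPi_eq_sum_of_pairwise (fun k ↦ Ψ (e k)) (fun k ↦ hA (e k))
      fun k l hkl ↦ h (e k) (e l) fun heq ↦ (ne_of_lt hkl) (e.injective heq)]
  exact Fintype.sum_equiv e _ _ fun _ ↦ rfl

/-- **Prop. 3.1 (proof) over an arbitrary finite index set**: pairwise `Hom(X_k, X_l) = 0` ⟹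
`ρ(∏_k X_k) ≤ Σ_k (dim X_k)²`. [cite: HulekLaface2019PicardNumbersAV, §3.1 Prop. 3.1 (proof)] -/
theorem finrank_neronSeveriGroup_sigmaPi_le_sum_sq_of_forall_ne (hA : ∀ k, IsAbelianVariety (Ψ k))
    (h : ∀ k l, k ≠ l → homRat (Ψ k) (Ψ l) = ⊥) :
    finrank ℤ (neronSeveriGroup (sigmaPiPeriod Ψ)) ≤ ∑ k, finrank ℂ (F k) ^ 2 := by
  rw [finrank_neronSeveriGroup_sigmaPi_eq_sum_of_forall_ne Ψ hA h]
  exact Finset.sum_le_sum fun k _ ↦ finrank_neronSeveriGroup_le_sq (Ψ k)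

variable {ρ : Type*} [Fintype ρ] [DecidableEq ρ] {τ : ρ → Type*} [∀ ν, Fintype (τ ν)] [∀ ν, DecidableEq (τ ν)]
  {G : ρ → Type*} [∀ ν, NormedAddCommGroup (G ν)] [∀ ν, NormedSpace ℂ (G ν)]
  (X : ∀ ν, (τ ν → ℝ) ≃L[ℝ] G ν) (n : ρ → ℕ)

omit [Fintype ρ] [DecidableEq ρ] in
/-- **"`Hom(X_ν^{n_ν}, X_μ^{n_μ}) = 0` for `ν ≠ μ`"** for simple, pairwise non-isogenous `X_ν`
(`dim_ℚ Hom_ℚ(X₁^{n₁}, X₂^{n₂}) = n₁ n₂ · dim_ℚ Hom_ℚ(X₁, X₂)` and Schur).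
[cite: Lange2023AbelianVarietiesComplex, §2.4.4 Cor. 2.4.26 (proof), p. 124] [cite: HulekLaface2019PicardNumbersAV, §2.1 Prop. 2.2 (proof: "`Hom(A_i, A_j) = Hom(A_i, A_j^∨) = 0`")] -/
theorem homRat_powPeriod_eq_bot_of_ne (hX : ∀ ν, IsSimple (X ν))
    (hXX : ∀ ν ν', ν ≠ ν' → ¬ IsIsogenous (X ν) (X ν')) {ν μ : ρ} (h : ν ≠ μ) :
    homRat (powPeriod (X ν) (n ν)) (powPeriod (X μ) (n μ)) = ⊥ := by
  rw [← Submodule.finrank_eq_zero, finrank_homRat_pow, (hX ν).homRat_eq_bot (hX μ) (hXX ν μ h), finrank_bot,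
    mul_zero]

/-- **Hulek–Laface 2019, Corollary 2.3, as printed.** "Let `A_1, …, A_r` be simple abelian varieties, such
that `A_i` is not isogenous to `A_j` for `i ≠ j`. Then, `ρ(∏_{i=1}^r A_i^{n_i}) = Σ_{i=1}^r ρ(A_i^{n_i})`":
for simple, pairwise non-isogenous abelian varieties `X_ν` (complex tori of arbitrary dimensions with a
polarisation) and exponents `n_ν ≥ 0`, the Picard number of the product of powers
`∏_ν X_ν^{n_ν} = ComplexTorus (sigmaPiPeriod fun ν ↦ powPeriod (X ν) (n ν))` is the sum of the Picard numbers
of the isotypic factors `X_ν^{n_ν}`. [cite: HulekLaface2019PicardNumbersAV, §2.1 Cor. 2.3] -/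
theorem finrank_neronSeveriGroup_powers (hX : ∀ ν, IsSimple (X ν)) (hA : ∀ ν, IsAbelianVariety (X ν))
    (hXX : ∀ ν ν', ν ≠ ν' → ¬ IsIsogenous (X ν) (X ν')) :
    finrank ℤ (neronSeveriGroup (sigmaPiPeriod fun ν ↦ powPeriod (X ν) (n ν))) =
      ∑ ν, finrank ℤ (neronSeveriGroup (powPeriod (X ν) (n ν))) :=
  finrank_neronSeveriGroup_sigmaPi_eq_sum_of_forall_ne _ (fun ν ↦ (hA ν).pow (n ν))
    fun _ _ h ↦ homRat_powPeriod_eq_bot_of_ne X n hX hXX h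

end Powers

/-! ## §5 The simplex maximisation of Prop. 3.1: `Σ k_ν² ≤ [Σ k_ν − (r−1)]² + (r−1)` for `k_ν ≥ 1` -/

section Simplex

variable {ρ : Type*} [Fintype ρ]

/-- `Σ_i a_i² ≤ (Σ_i a_i)²` for natural numbers. [folklore] -/
private theorem sum_sq_le_sq_sum (a : ρ → ℕ) : ∑ i, a i ^ 2 ≤ (∑ i, a i) ^ 2 := by
  rw [sq (∑ i, a i), Finset.sum_mul]
  exact Finset.sum_le_sum fun i _ ↦ by
    rw [sq]
    exact Nat.mul_le_mul_left _ (Finset.single_le_sum (fun j _ ↦ Nat.zero_le (a j)) (Finset.mem_univ i))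

/-- `(Σ_i a_i)² ≤ Σ_i a_i²` for natural numbers forces `a_i a_j = 0` for `i ≠ j`. [folklore] -/
private theorem eq_zero_or_eq_zero_of_sq_sum_le [DecidableEq ρ] (a : ρ → ℕ)
    (h : (∑ i, a i) ^ 2 ≤ ∑ i, a i ^ 2) {i j : ρ} (hij : i ≠ j) : a i = 0 ∨ a j = 0 := by
  have hpair : ∀ x, a i * a j * ((if x = i then 1 else 0) + if x = j then 1 else 0) + a x ^ 2 ≤
      a x * ∑ y, a y := by
    intro x
    have h2 : a i + a j ≤ ∑ y, a y := by
      rw [← Finset.sum_pair hij]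
      exact Finset.sum_le_sum_of_subset_of_nonneg (Finset.subset_univ _) fun _ _ _ ↦ Nat.zero_le _
    by_cases hxi : x = i
    · subst hxi
      rw [if_pos rfl, if_neg hij]
      nlinarith [h2]
    · by_cases hxj : x = j
      · subst hxj
        rw [if_neg hxi, if_pos rfl]
        nlinarith [h2]
      · rw [if_neg hxi, if_neg hxj, add_zero, mul_zero, zero_add, sq]
        exact Nat.mul_le_mul_left _ (Finset.single_le_sum (fun y _ ↦ Nat.zero_le (a y)) (Finset.mem_univ x))
  have hsum := Finset.sum_le_sum fun x (_ : x ∈ Finset.univ) ↦ hpair x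
  rw [← Finset.sum_mul, ← sq, Finset.sum_add_distrib, ← Finset.mul_sum, Finset.sum_add_distrib,
    Finset.sum_ite_eq' Finset.univ i, Finset.sum_ite_eq' Finset.univ j, if_pos (Finset.mem_univ _),
    if_pos (Finset.mem_univ _)] at hsum
  have h0 : a i * a j = 0 := by omega
  exact mul_eq_zero.1 h0

variable (k : ρ → ℕ)

/-- **The maximisation in the proof of Prop. 3.1**: "we are looking for the maxima of the function
`h(x_1, …, x_r) = x_1² + ⋯ + x_r²` on the integral points of the simplex
`Ω_{r,g} = {(x_1, …, x_r) ∣ x_i ≥ 1, x_1 + ⋯ + x_r = g}` […] the maximum is attained at any of these points,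
with value `h(g−r+1, 1, …, 1) = [g − (r−1)]² + (r−1)`": for `k_ν ≥ 1`,
`Σ_ν k_ν² ≤ [Σ_ν k_ν − (r−1)]² + (r−1)`, `r = |ρ|`. [cite: HulekLaface2019PicardNumbersAV, §3.1 Prop. 3.1 (proof)] -/
theorem sum_sq_le_sq_sub_add (hk : ∀ ν, 1 ≤ k ν) :
    ∑ ν, k ν ^ 2 ≤ (∑ ν, k ν - (Fintype.card ρ - 1)) ^ 2 + (Fintype.card ρ - 1) := by
  rcases isEmpty_or_nonempty ρ with hρ | hρ
  · simp
  obtain ⟨r', hr'⟩ : ∃ r', Fintype.card ρ = r' + 1 := Nat.exists_eq_add_one.2 Fintype.card_pos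
  set a : ρ → ℕ := fun ν ↦ k ν - 1 with ha
  have hka : ∀ ν, k ν = a ν + 1 := fun ν ↦ (Nat.sub_add_cancel (hk ν)).symm
  have hsum : ∑ ν, k ν = ∑ ν, a ν + Fintype.card ρ := by
    simp_rw [hka]
    rw [Finset.sum_add_distrib, Finset.sum_const, Finset.card_univ, smul_eq_mul, mul_one]
  have hsq : ∑ ν, k ν ^ 2 = ∑ ν, (a ν ^ 2 + 2 * a ν + 1) :=
    Finset.sum_congr rfl fun ν _ ↦ by rw [hka]; ring
  rw [hsq, Finset.sum_add_distrib, Finset.sum_add_distrib, Finset.sum_const, Finset.card_univ, smul_eq_mul,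
    mul_one, ← Finset.mul_sum, hsum, hr', Nat.add_sub_cancel,
    show ∑ ν, a ν + (r' + 1) - r' = ∑ ν, a ν + 1 by omega]
  nlinarith [sum_sq_le_sq_sum a]

/-- **The equality case of the maximisation** ("These points are precisely the vertices
`(g−r+1, 1, …, 1), (1, g−r+1, 1, …, 1), …, (1, …, 1, g−r+1)`"): if `k_ν ≥ 1` and
`Σ_ν k_ν² ≥ [Σ_ν k_ν − (r−1)]² + (r−1)` then at most one `k_ν` exceeds `1`.
[cite: HulekLaface2019PicardNumbersAV, §3.1 Prop. 3.1 (proof)] -/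
theorem eq_one_or_eq_one_of_sq_sub_add_le [DecidableEq ρ] (hk : ∀ ν, 1 ≤ k ν)
    (h : (∑ ν, k ν - (Fintype.card ρ - 1)) ^ 2 + (Fintype.card ρ - 1) ≤ ∑ ν, k ν ^ 2) {ν ν' : ρ}
    (hne : ν ≠ ν') : k ν = 1 ∨ k ν' = 1 := by
  haveI : Nonempty ρ := ⟨ν⟩
  obtain ⟨r', hr'⟩ : ∃ r', Fintype.card ρ = r' + 1 := Nat.exists_eq_add_one.2 Fintype.card_pos
  set a : ρ → ℕ := fun ν ↦ k ν - 1 with ha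
  have hka : ∀ ν, k ν = a ν + 1 := fun ν ↦ (Nat.sub_add_cancel (hk ν)).symm
  have hsum : ∑ ν, k ν = ∑ ν, a ν + Fintype.card ρ := by
    simp_rw [hka]
    rw [Finset.sum_add_distrib, Finset.sum_const, Finset.card_univ, smul_eq_mul, mul_one]
  have hsq : ∑ ν, k ν ^ 2 = ∑ ν, (a ν ^ 2 + 2 * a ν + 1) :=
    Finset.sum_congr rfl fun ν _ ↦ by rw [hka]; ring
  rw [hsq, Finset.sum_add_distrib, Finset.sum_add_distrib, Finset.sum_const, Finset.card_univ, smul_eq_mul,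
    mul_one, ← Finset.mul_sum, hsum, hr', Nat.add_sub_cancel,
    show ∑ ν, a ν + (r' + 1) - r' = ∑ ν, a ν + 1 by omega] at h
  have h' : (∑ μ, a μ) ^ 2 ≤ ∑ μ, a μ ^ 2 := by nlinarith [h]
  rcases eq_zero_or_eq_zero_of_sq_sum_le a h' hne with h0 | h0
  · exact Or.inl (by rw [hka, h0])
  · exact Or.inr (by rw [hka, h0])

/-- The vertex value: if all `k_ν = 1` except possibly `k_{ν₀}`, then
`Σ_ν k_ν² = [Σ_ν k_ν − (r−1)]² + (r−1)` and `k_{ν₀} = Σ_ν k_ν − (r−1)`. [cite: HulekLaface2019PicardNumbersAV, §3.1 Prop. 3.1 (proof: "`h(g−r+1, 1, …, 1) = [g−(r−1)]² + (r−1)`")] -/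
theorem sum_eq_add_card_sub_one_of_forall_ne [DecidableEq ρ] {ν₀ : ρ} (h : ∀ ν, ν ≠ ν₀ → k ν = 1) :
    ∑ ν, k ν = k ν₀ + (Fintype.card ρ - 1) ∧ ∑ ν, k ν ^ 2 = k ν₀ ^ 2 + (Fintype.card ρ - 1) := by
  have hcard : (Finset.univ.erase ν₀).card = Fintype.card ρ - 1 := by
    rw [Finset.card_erase_of_mem (Finset.mem_univ _), Finset.card_univ]
  have h1 : ∑ ν ∈ Finset.univ.erase ν₀, k ν = Fintype.card ρ - 1 := by
    rw [Finset.sum_congr rfl fun ν hν ↦ h ν (Finset.ne_of_mem_erase hν), Finset.sum_const, hcard,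
      smul_eq_mul, mul_one]
  have h2 : ∑ ν ∈ Finset.univ.erase ν₀, k ν ^ 2 = Fintype.card ρ - 1 := by
    rw [Finset.sum_congr rfl fun ν hν ↦ by rw [h ν (Finset.ne_of_mem_erase hν), one_pow], Finset.sum_const,
      hcard, smul_eq_mul, mul_one]
  constructor
  · rw [← Finset.add_sum_erase _ _ (Finset.mem_univ ν₀), h1]
  · rw [← Finset.add_sum_erase _ _ (Finset.mem_univ ν₀), h2]

end Simplex

/-! ## §6 Prop. 3.1: `ρ(A) ≤ M_{r(A),g} = [g − (r−1)]² + (r−1)` along a Poincaré decomposition of length `r` -/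

section PropThreeOne

variable {ι : Type*} [Fintype ι] {E : Type*} [NormedAddCommGroup E] [NormedSpace ℂ E]

include ι in
/-- The covering space `E ≅ ℝ^ι` of a complex torus is finite-dimensional over `ℂ`. [cite: Lange2023AbelianVarietiesComplex, §1.1.1] -/
private theorem finiteDimensional_complex_of_period (Φ : (ι → ℝ) ≃L[ℝ] E) : FiniteDimensional ℂ E := by
  haveI : FiniteDimensional ℝ E := LinearEquiv.finiteDimensional Φ.toLinearEquiv
  exact Module.Finite.of_restrictScalars_finite ℝ ℂ E

/-- A torus with a nonempty lattice basis has positive dimension (`|ι| = 2 dim_ℂ E`). [cite: Lange2023AbelianVarietiesComplex, §1.1.1] -/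
theorem finrank_pos_of_nonempty [Nonempty ι] (Φ : (ι → ℝ) ≃L[ℝ] E) : 0 < finrank ℂ E := by
  haveI := finiteDimensional_complex_of_period Φ
  have h := card_eq_two_mul_finrank Φ
  have hι : 0 < Fintype.card ι := Fintype.card_pos
  omega

/-- `dim_ℂ (Eᵐ) = m · dim_ℂ E`. [folklore] -/
private theorem finrank_fin_fun (m : ℕ) (E : Type*) [NormedAddCommGroup E] [NormedSpace ℂ E]
    [FiniteDimensional ℂ E] : finrank ℂ (Fin m → E) = m * finrank ℂ E := by
  rw [Module.finrank_pi_fintype, Finset.sum_const, Finset.card_univ, Fintype.card_fin, smul_eq_mul]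

/-- `ρ(Xᵐ) ≤ (m · dim X)²` (`ρ ≤ h^{1,1} = dim²`, Exercise 1.3.4 (10)(b), for the power torus).
[cite: Lange2023AbelianVarietiesComplex, §1.3.1 Exercise 1.3.4 (10)(b)] [cite: HulekLaface2019PicardNumbersAV, §1 ("`1 ≤ ρ ≤ g²`")] -/
theorem finrank_neronSeveriGroup_powPeriod_le_sq (Φ : (ι → ℝ) ≃L[ℝ] E) (m : ℕ) :
    finrank ℤ (neronSeveriGroup (powPeriod Φ m)) ≤ (m * finrank ℂ E) ^ 2 := by
  haveI := finiteDimensional_complex_of_period Φ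
  rw [← finrank_fin_fun m E]
  exact finrank_neronSeveriGroup_le_sq (powPeriod Φ m)

variable [DecidableEq ι]
  {ρ : Type*} [Fintype ρ] [DecidableEq ρ] {τ : ρ → Type*} [∀ ν, Fintype (τ ν)] [∀ ν, DecidableEq (τ ν)]
  {G : ρ → Type*} [∀ ν, NormedAddCommGroup (G ν)] [∀ ν, NormedSpace ℂ (G ν)]
  (X : ∀ ν, (τ ν → ℝ) ≃L[ℝ] G ν) (n : ρ → ℕ)

omit [DecidableEq ρ] [∀ ν, DecidableEq (τ ν)] in
include X in
/-- **`dim (∏_ν X_ν^{n_ν}) = Σ_ν n_ν · dim X_ν`** (the dimension bookkeeping `g = Σ_ν n_ν dim X_ν` of a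
Poincaré decomposition). [cite: Lange2023AbelianVarietiesComplex, §2.4.4 Thm. 2.4.25, p. 123] -/
theorem finrank_powers_eq : finrank ℂ (∀ ν, Fin (n ν) → G ν) = ∑ ν, n ν * finrank ℂ (G ν) := by
  haveI : ∀ ν, FiniteDimensional ℂ (G ν) := fun ν ↦ finiteDimensional_complex_of_period (X ν)
  rw [Module.finrank_pi_fintype]
  exact Finset.sum_congr rfl fun ν _ ↦ finrank_fin_fun (n ν) (G ν)

/-- **Prop. 3.1 (proof), first inequality, along a Poincaré decomposition:
`ρ(∏_ν X_ν^{n_ν}) ≤ Σ_ν k_ν²`, `k_ν = n_ν dim X_ν = dim X_ν^{n_ν}`** ("`ρ(A) ≤ k_1² + ⋯ + k_r²` where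
`k_i := dim A_i`", the `A_i = X_i^{n_i}` being the pairwise `Hom`-orthogonal isotypic factors).
[cite: HulekLaface2019PicardNumbersAV, §3.1 Prop. 3.1 (proof)] -/
theorem finrank_neronSeveriGroup_powers_le_sum_sq (hX : ∀ ν, IsSimple (X ν))
    (hA : ∀ ν, IsAbelianVariety (X ν)) (hXX : ∀ ν ν', ν ≠ ν' → ¬ IsIsogenous (X ν) (X ν')) :
    finrank ℤ (neronSeveriGroup (sigmaPiPeriod fun ν ↦ powPeriod (X ν) (n ν))) ≤
      ∑ ν, (n ν * finrank ℂ (G ν)) ^ 2 := by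
  rw [finrank_neronSeveriGroup_powers X n hX hA hXX]
  exact Finset.sum_le_sum fun ν _ ↦ finrank_neronSeveriGroup_powPeriod_le_sq (X ν) (n ν)

variable [∀ ν, Nonempty (τ ν)]

omit [Fintype ρ] [DecidableEq ρ] [∀ ν, DecidableEq (τ ν)] in
include X in
/-- The isotypic factors of a Poincaré decomposition are positive-dimensional: `k_ν = n_ν dim X_ν ≥ 1`. [cite: HulekLaface2019PicardNumbersAV, §3.1 Prop. 3.1 (proof: "`x_i ≥ 1`")] -/
theorem one_le_mul_finrank (hn : ∀ ν, 0 < n ν) (ν : ρ) : 1 ≤ n ν * finrank ℂ (G ν) :=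
  Nat.mul_pos (hn ν) (finrank_pos_of_nonempty (X ν))

/-- **Hulek–Laface 2019, Proposition 3.1: `ρ ≤ M_{r,g} = [g − (r−1)]² + (r−1)` along a Poincaré
decomposition of length `r`.** For simple, nonzero, pairwise non-isogenous abelian varieties `X_ν`
(`ν ∈ ρ`, `r = |ρ|`) and exponents `n_ν ≥ 1`, the product `∏_ν X_ν^{n_ν}` of dimension
`g = Σ_ν n_ν dim X_ν` has `ρ(∏_ν X_ν^{n_ν}) ≤ [g − (r−1)]² + (r−1)` ("`ρ(A) ≤ k_1² + ⋯ + k_r²` […] Therefore,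
we conclude that `ρ(A) ≤ [g − (r−1)]² + (r−1)`"). The value is attained
(`exists_pi_ellipticPeriod_finrank_neronSeveriGroup_eq` of `ComplexTorusPicardNumberFiniteProduct.lean`).
[cite: HulekLaface2019PicardNumbersAV, §3.1 Prop. 3.1] -/
theorem finrank_neronSeveriGroup_powers_le (hX : ∀ ν, IsSimple (X ν)) (hA : ∀ ν, IsAbelianVariety (X ν))
    (hXX : ∀ ν ν', ν ≠ ν' → ¬ IsIsogenous (X ν) (X ν')) (hn : ∀ ν, 0 < n ν) :
    finrank ℤ (neronSeveriGroup (sigmaPiPeriod fun ν ↦ powPeriod (X ν) (n ν))) ≤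
      (∑ ν, n ν * finrank ℂ (G ν) - (Fintype.card ρ - 1)) ^ 2 + (Fintype.card ρ - 1) :=
  (finrank_neronSeveriGroup_powers_le_sum_sq X n hX hA hXX).trans
    (sum_sq_le_sq_sub_add _ (one_le_mul_finrank X n hn))

/-- **Proposition 3.1 for the isogeny class, as printed: "`M_{r,g} := max{ρ(A) ∣ dim A = g, r(A) = r}` …
`M_{r,g} = [g − (r−1)]² + (r−1)`", i.e. `ρ(A) ≤ [g − (r(A)−1)]² + (r(A)−1)` for every abelian variety `A`
of dimension `g`**, where `r(A)` is "the length of a decomposition according to Poincaré Complete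
Reducibility Theorem": if `A ∼ ∏_{ν ∈ ρ} X_ν^{n_ν}` with simple, nonzero, pairwise non-isogenous abelian
varieties `X_ν` and `n_ν ≥ 1` (such a decomposition exists by `poincare_complete_reducibility_powers`, and
`r = |ρ|` does not depend on it by `card_eq_of_isIsogenous_powers`), then
`ρ(A) ≤ [dim A − (r−1)]² + (r−1)`. [cite: HulekLaface2019PicardNumbersAV, §3.1 Prop. 3.1 and the definition of `r(A)`, `M_{r,g}`] -/
theorem IsIsogenous.finrank_neronSeveriGroup_le_of_powers {A : (ι → ℝ) ≃L[ℝ] E}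
    (hiso : IsIsogenous A (sigmaPiPeriod fun ν ↦ powPeriod (X ν) (n ν))) (hX : ∀ ν, IsSimple (X ν))
    (hA : ∀ ν, IsAbelianVariety (X ν)) (hXX : ∀ ν ν', ν ≠ ν' → ¬ IsIsogenous (X ν) (X ν'))
    (hn : ∀ ν, 0 < n ν) :
    finrank ℤ (neronSeveriGroup A) ≤ (finrank ℂ E - (Fintype.card ρ - 1)) ^ 2 + (Fintype.card ρ - 1) := by
  rw [hiso.finrank_neronSeveriGroup_eq _ _, hiso.finrank_eq _ _, finrank_powers_eq X n]
  exact finrank_neronSeveriGroup_powers_le X n hX hA hXX hn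

/-- **Remark 3.3: the maxima `M_{r,g}` decrease strictly in `r`** ("`g = M_{g,g} < M_{g−1,g} < ⋯ < M_{2,g} <
M_{1,g} = g²`"): for `1 ≤ r < r' ≤ g`, `[g − (r'−1)]² + (r'−1) < [g − (r−1)]² + (r−1)`.
[cite: HulekLaface2019PicardNumbersAV, §3.1 Remark 3.3] -/
theorem sq_sub_add_lt_sq_sub_add {g r r' : ℕ} (hr : 1 ≤ r) (hrr' : r < r') (hr'g : r' ≤ g) :
    (g - (r' - 1)) ^ 2 + (r' - 1) < (g - (r - 1)) ^ 2 + (r - 1) := by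
  obtain ⟨a, rfl⟩ : ∃ a, r = a + 1 := ⟨r - 1, by omega⟩
  obtain ⟨d, rfl⟩ : ∃ d, r' = a + 1 + (d + 1) := ⟨r' - (a + 1) - 1, by omega⟩
  obtain ⟨u, rfl⟩ : ∃ u, g = a + 1 + (d + 1) + u := ⟨g - (a + 1 + (d + 1)), by omega⟩
  have e1 : a + 1 + (d + 1) + u - (a + 1 + (d + 1) - 1) = u + 1 := by omega
  have e2 : a + 1 + (d + 1) + u - (a + 1 - 1) = u + d + 2 := by omega
  have e3 : a + 1 + (d + 1) - 1 = a + d + 1 := by omega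
  have e4 : a + 1 - 1 = a := by omega
  rw [e1, e2, e3, e4]
  nlinarith

/-- `M_{g,g} = g` and `M_{1,g} = g²` (the two ends of the chain of Remark 3.3). [cite: HulekLaface2019PicardNumbersAV, §3.1 Remark 3.3] -/
theorem sq_sub_add_self_and_one (g : ℕ) (hg : 1 ≤ g) :
    (g - (g - 1)) ^ 2 + (g - 1) = g ∧ (g - (1 - 1)) ^ 2 + (1 - 1) = g ^ 2 := by
  constructor
  · rw [show g - (g - 1) = 1 by omega, one_pow]
    omega
  · simp

/-- **Thm. 1.1 (1), case (a), for every abelian variety: "Since `r(A) ≥ 2`, we have that `A ∼ A_1 × A_2`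
with `Hom(A_1,A_2) = 0` […] Therefore, `ρ(A) ≤ (g−1)² + 1`"** — if `A` has a Poincaré decomposition of
length `r ≥ 2` then `ρ(A) ≤ (g − 1)² + 1 = M_{2,g}` (`M_{r,g} ≤ M_{2,g}`, Remark 3.3).
[cite: HulekLaface2019PicardNumbersAV, §3.2 (a) and §3.1 Prop. 3.1, Remark 3.3] -/
theorem IsIsogenous.finrank_neronSeveriGroup_le_sq_pred_add_one_of_two_le_card {A : (ι → ℝ) ≃L[ℝ] E}
    (hiso : IsIsogenous A (sigmaPiPeriod fun ν ↦ powPeriod (X ν) (n ν))) (hX : ∀ ν, IsSimple (X ν))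
    (hA : ∀ ν, IsAbelianVariety (X ν)) (hXX : ∀ ν ν', ν ≠ ν' → ¬ IsIsogenous (X ν) (X ν'))
    (hn : ∀ ν, 0 < n ν) (h2 : 2 ≤ Fintype.card ρ) :
    finrank ℤ (neronSeveriGroup A) ≤ (finrank ℂ E - 1) ^ 2 + 1 := by
  have hle := hiso.finrank_neronSeveriGroup_le_of_powers X n hX hA hXX hn
  -- `r ≤ g`: every isotypic factor has dimension `≥ 1`
  have hrg : Fintype.card ρ ≤ finrank ℂ E := by
    rw [hiso.finrank_eq _ _, finrank_powers_eq X n]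
    calc Fintype.card ρ = ∑ _ν : ρ, 1 := by simp
      _ ≤ ∑ ν, n ν * finrank ℂ (G ν) := Finset.sum_le_sum fun ν _ ↦ one_le_mul_finrank X n hn ν
  rcases (show 2 = Fintype.card ρ ∨ 2 < Fintype.card ρ by omega) with h | h
  · rw [← h] at hle
    exact hle
  · exact hle.trans (sq_sub_add_lt_sq_sub_add (g := finrank ℂ E) (by norm_num) h hrg).le

end PropThreeOne

/-! ## §7 Cor. 3.2: the extremal case `ρ(A) = M_{r(A),g}` -/

section CorThreeTwo

variable {ι : Type*} [Fintype ι] [DecidableEq ι] {E : Type*} [NormedAddCommGroup E] [NormedSpace ℂ E]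
  {ρ : Type*} [Fintype ρ] [DecidableEq ρ] {τ : ρ → Type*} [∀ ν, Fintype (τ ν)] [∀ ν, DecidableEq (τ ν)]
  [∀ ν, Nonempty (τ ν)]
  {G : ρ → Type*} [∀ ν, NormedAddCommGroup (G ν)] [∀ ν, NormedSpace ℂ (G ν)]
  (X : ∀ ν, (τ ν → ℝ) ≃L[ℝ] G ν) (n : ρ → ℕ)

/-- **A simple torus `X` with `Xⁿ ∼ E_θᵏ` (`n, k ≥ 1`) is the elliptic curve: `X ∼ E_θ` and `n = k`** —
Poincaré uniqueness (`poincare_complete_reducibility_unique_powers`) for the one-factor decompositions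
`Xⁿ` and `E_θᵏ`. [cite: Lange2023AbelianVarietiesComplex, §2.4.4 Thm. 2.4.25 (uniqueness), p. 123] -/
theorem IsSimple.isIsogenous_ellipticPeriod_of_pow {κ : Type*} [Fintype κ] [DecidableEq κ] [Nonempty κ]
    {H : Type*} [NormedAddCommGroup H] [NormedSpace ℂ H] {Y : (κ → ℝ) ≃L[ℝ] H} (hY : IsSimple Y)
    {m k : ℕ} (hm : 0 < m) (hk : 0 < k) {θ : ℂ} (hθ : θ.im ≠ 0)
    (h : IsIsogenous (powPeriod Y m) (powPeriod (ellipticPeriod hθ) k)) :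
    IsIsogenous Y (ellipticPeriod hθ) ∧ m = k := by
  have h' : IsIsogenous (sigmaPiPeriod fun _ : Fin 1 ↦ powPeriod Y m)
      (sigmaPiPeriod fun _ : Fin 1 ↦ powPeriod (ellipticPeriod hθ) k) :=
    IsIsogenous.trans _ _ _
      (IsIsogenous.trans _ _ _ (isIsomorphic_sigmaPiPeriod_unique fun _ : Fin 1 ↦ powPeriod Y m).isIsogenous h)
      (isIsomorphic_sigmaPiPeriod_unique fun _ : Fin 1 ↦ powPeriod (ellipticPeriod hθ) k).symm.isIsogenous
  obtain ⟨e, he⟩ := poincare_complete_reducibility_unique_powers (X := fun _ : Fin 1 ↦ Y) (n := fun _ ↦ m)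
    (X' := fun _ : Fin 1 ↦ ellipticPeriod hθ) (m := fun _ ↦ k) (fun _ ↦ hY)
    (fun i j hij ↦ absurd (Subsingleton.elim i j) hij) (fun _ ↦ hm) (fun _ ↦ isSimple_ellipticPeriod hθ)
    (fun i j hij ↦ absurd (Subsingleton.elim i j) hij) (fun _ ↦ hk) h'
  exact he 0

/-- **Hulek–Laface 2019, Corollary 3.2, along a Poincaré decomposition.** For simple, nonzero, pairwise
non-isogenous abelian varieties `X_ν` (`ν ∈ ρ`, `r = |ρ| ≥ 1`), exponents `n_ν ≥ 1` and
`g = Σ_ν n_ν dim X_ν`: **`ρ(∏_ν X_ν^{n_ν}) = [g − (r−1)]² + (r−1)` iff there is `ν₀` such that every `X_ν` is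
an elliptic curve (`dim X_ν = 1`), `n_ν = 1` for `ν ≠ ν₀`, and `X_{ν₀}` has complex multiplication
(`dim_ℚ End_ℚ(X_{ν₀}) = 2`) whenever `n_{ν₀} = g − (r−1) ≥ 2`** ("`ρ(A) = M_{r(A),g} ⟺
A ∼ E^{g−(r−1)} × E_1 × ⋯ × E_{r−1}`, where `E` is a CM elliptic curve not isogenous to any of the `E_i`'s,
and `E_i` and `E_j` are not isogenous for `i ≠ j`"). Proof: equality in Prop. 3.1 forces the vertex shape
`(k_ν) = (g−r+1, 1, …, 1)` (`eq_one_or_eq_one_of_sq_sub_add_le`) and `ρ(X_ν^{n_ν}) = k_ν²` for every `ν`;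
`ρ(Xⁿ) = (n dim X)²` with `n dim X ≥ 2` gives `Xⁿ ∼ E_θ^{n dim X}` with `E_θ` CM
(`finrank_neronSeveriGroup_eq_sq_iff_exists_isIsogenous_ellipticPow_cm`), whence `X ∼ E_θ`, `dim X = 1` by
Poincaré uniqueness. Recorded scope: for `r = g` (all `n_ν dim X_ν = 1`, `M_{g,g} = g`) no CM condition
arises — every product of `g` pairwise non-isogenous elliptic curves has `ρ = g`
(`finrank_neronSeveriGroup_pi_ellipticPeriod_of_pairwise_not_isIsogenous`), which is why the CM clause is
stated under `n_{ν₀} ≥ 2`. [cite: HulekLaface2019PicardNumbersAV, §3.1 Cor. 3.2] -/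
theorem finrank_neronSeveriGroup_powers_eq_iff [Nonempty ρ] (hX : ∀ ν, IsSimple (X ν))
    (hA : ∀ ν, IsAbelianVariety (X ν)) (hXX : ∀ ν ν', ν ≠ ν' → ¬ IsIsogenous (X ν) (X ν'))
    (hn : ∀ ν, 0 < n ν) :
    finrank ℤ (neronSeveriGroup (sigmaPiPeriod fun ν ↦ powPeriod (X ν) (n ν))) =
        (∑ ν, n ν * finrank ℂ (G ν) - (Fintype.card ρ - 1)) ^ 2 + (Fintype.card ρ - 1) ↔
      ∃ ν₀, (∀ ν, finrank ℂ (G ν) = 1) ∧ (∀ ν, ν ≠ ν₀ → n ν = 1) ∧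
        (2 ≤ n ν₀ → finrank ℚ (endAlgRat (X ν₀)) = 2) := by
  haveI : ∀ ν, FiniteDimensional ℂ (G ν) := fun ν ↦ finiteDimensional_complex_of_period (X ν)
  set k : ρ → ℕ := fun ν ↦ n ν * finrank ℂ (G ν) with hk
  have hk1 : ∀ ν, 1 ≤ k ν := one_le_mul_finrank X n hn
  have hρν : ∀ ν, finrank ℤ (neronSeveriGroup (powPeriod (X ν) (n ν))) ≤ k ν ^ 2 := fun ν ↦
    finrank_neronSeveriGroup_powPeriod_le_sq (X ν) (n ν)
  have hk_one : ∀ ν, k ν = 1 → n ν = 1 ∧ finrank ℂ (G ν) = 1 := fun ν h1 ↦ mul_eq_one.1 h1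
  have hdimpow : ∀ ν, finrank ℂ (Fin (n ν) → G ν) = k ν := fun ν ↦ finrank_fin_fun (n ν) (G ν)
  constructor
  · intro h
    rw [finrank_neronSeveriGroup_powers X n hX hA hXX] at h
    have hle1 : ∑ ν, finrank ℤ (neronSeveriGroup (powPeriod (X ν) (n ν))) ≤ ∑ ν, k ν ^ 2 :=
      Finset.sum_le_sum fun ν _ ↦ hρν ν
    have hle2 : ∑ ν, k ν ^ 2 ≤ (∑ ν, k ν - (Fintype.card ρ - 1)) ^ 2 + (Fintype.card ρ - 1) :=
      sum_sq_le_sq_sub_add k hk1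
    have hsumeq : ∑ ν, finrank ℤ (neronSeveriGroup (powPeriod (X ν) (n ν))) = ∑ ν, k ν ^ 2 :=
      le_antisymm hle1 (h ▸ hle2)
    have heach : ∀ ν, finrank ℤ (neronSeveriGroup (powPeriod (X ν) (n ν))) = k ν ^ 2 := fun ν ↦
      (Finset.sum_eq_sum_iff_of_le fun μ _ ↦ hρν μ).1 hsumeq ν (Finset.mem_univ ν)
    have hvert : (∑ ν, k ν - (Fintype.card ρ - 1)) ^ 2 + (Fintype.card ρ - 1) ≤ ∑ ν, k ν ^ 2 := by
      rw [← h]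
      exact hle1
    have hone : ∀ ν ν', ν ≠ ν' → k ν = 1 ∨ k ν' = 1 := fun ν ν' hne ↦
      eq_one_or_eq_one_of_sq_sub_add_le k hk1 hvert hne
    obtain ⟨ν₀, hν₀⟩ : ∃ ν₀, ∀ ν, ν ≠ ν₀ → k ν = 1 := by
      by_cases hex : ∃ ν, k ν ≠ 1
      · obtain ⟨ν₀, h0⟩ := hex
        exact ⟨ν₀, fun ν hν ↦ (hone ν ν₀ hν).resolve_right h0⟩
      · push Not at hex
        exact ⟨Classical.arbitrary ρ, fun ν _ ↦ hex ν⟩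
    have h0 : finrank ℂ (G ν₀) = 1 ∧ (2 ≤ n ν₀ → finrank ℚ (endAlgRat (X ν₀)) = 2) := by
      by_cases hk0 : k ν₀ = 1
      · exact ⟨(hk_one ν₀ hk0).2, fun h2 ↦ absurd (hk_one ν₀ hk0).1 (by omega)⟩
      · have hk2 : 2 ≤ k ν₀ := by have := hk1 ν₀; omega
        have hmax : finrank ℤ (neronSeveriGroup (powPeriod (X ν₀) (n ν₀))) =
            (finrank ℂ (Fin (n ν₀) → G ν₀)) ^ 2 := by rw [hdimpow, heach]
        obtain ⟨θ, hθ, hcm, hiso⟩ :=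
          (finrank_neronSeveriGroup_eq_sq_iff_exists_isIsogenous_ellipticPow_cm (powPeriod (X ν₀) (n ν₀))
            (by rw [hdimpow]; exact hk2)).1 hmax
        rw [hdimpow] at hiso
        obtain ⟨hXE, hnk⟩ := (hX ν₀).isIsogenous_ellipticPeriod_of_pow (hn ν₀)
          (lt_of_lt_of_le two_pos hk2) hθ hiso
        have hd : finrank ℂ (G ν₀) = 1 := by
          rw [hXE.finrank_eq _ _]
          exact Module.finrank_self ℂ
        exact ⟨hd, fun _ ↦ by rw [hXE.finrank_endAlgRat_eq, finrank_endAlgRat_ellipticPeriod_eq_two_iff]; exact hcm⟩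
    refine ⟨ν₀, fun ν ↦ ?_, fun ν hν ↦ (hk_one ν (hν₀ ν hν)).1, h0.2⟩
    by_cases hν : ν = ν₀
    · rw [hν]
      exact h0.1
    · exact (hk_one ν (hν₀ ν hν)).2
  · rintro ⟨ν₀, hdim, hn1, hcm⟩
    rw [finrank_neronSeveriGroup_powers X n hX hA hXX]
    have hkν : ∀ ν, ν ≠ ν₀ → k ν = 1 := fun ν hν ↦ by rw [hk]; simp only [hn1 ν hν, hdim ν]
    have hterm : ∀ ν, finrank ℤ (neronSeveriGroup (powPeriod (X ν) (n ν))) = k ν ^ 2 := by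
      intro ν
      have hkn : k ν = n ν := by rw [hk]; simp only [hdim ν, mul_one]
      rw [hkn]
      rcases Nat.lt_or_ge (n ν) 2 with hlt | hge
      · have hn1' : n ν = 1 := by have := hn ν; omega
        rw [hn1', one_pow]
        exact finrank_neronSeveriGroup_eq_one_of_finrank_eq_one _ (by rw [finrank_fin_fun, hdim ν, mul_one])
      · have hν : ν = ν₀ := by
          by_contra hν
          have := hn1 ν hν
          omega
        subst hν
        exact (finrank_neronSeveriGroup_pow_eq_sq_iff_of_finrank_eq_one (X ν) hge (hdim ν)).2 (hcm hge)
    rw [Finset.sum_congr rfl fun ν _ ↦ hterm ν]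
    obtain ⟨hs1, hs2⟩ := sum_eq_add_card_sub_one_of_forall_ne k hkν
    rw [hs2, hs1, Nat.add_sub_cancel]

/-- **Cor. 3.2 for the isogeny class, as printed: `ρ(A) = M_{r(A),g}` iff the Poincaré decomposition of `A`
has the shape `E^{g−(r−1)} × E_1 × ⋯ × E_{r−1}`** — for `A ∼ ∏_{ν ∈ ρ} X_ν^{n_ν}` (simple, nonzero, pairwise
non-isogenous abelian varieties `X_ν`, `n_ν ≥ 1`, `r = |ρ|`, `g = dim A`):
`ρ(A) = [g − (r−1)]² + (r−1)` iff all `X_ν` are elliptic curves, all exponents but one (`n_{ν₀}`) are `1`, and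
`X_{ν₀}` has complex multiplication when `n_{ν₀} ≥ 2`. [cite: HulekLaface2019PicardNumbersAV, §3.1 Cor. 3.2] -/
theorem IsIsogenous.finrank_neronSeveriGroup_eq_iff_of_powers [Nonempty ρ] {A : (ι → ℝ) ≃L[ℝ] E}
    (hiso : IsIsogenous A (sigmaPiPeriod fun ν ↦ powPeriod (X ν) (n ν))) (hX : ∀ ν, IsSimple (X ν))
    (hA : ∀ ν, IsAbelianVariety (X ν)) (hXX : ∀ ν ν', ν ≠ ν' → ¬ IsIsogenous (X ν) (X ν'))
    (hn : ∀ ν, 0 < n ν) :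
    finrank ℤ (neronSeveriGroup A) = (finrank ℂ E - (Fintype.card ρ - 1)) ^ 2 + (Fintype.card ρ - 1) ↔
      ∃ ν₀, (∀ ν, finrank ℂ (G ν) = 1) ∧ (∀ ν, ν ≠ ν₀ → n ν = 1) ∧
        (2 ≤ n ν₀ → finrank ℚ (endAlgRat (X ν₀)) = 2) := by
  rw [hiso.finrank_neronSeveriGroup_eq _ _, hiso.finrank_eq _ _, finrank_powers_eq X n]
  exact finrank_neronSeveriGroup_powers_eq_iff X n hX hA hXX hn

/-- **Cor. 3.2, the printed shape `A ∼ E^{g−(r−1)} × E_1 × ⋯ × E_{r−1}`.** If `ρ(∏_ν X_ν^{n_ν}) =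
[g − (r−1)]² + (r−1)` with `g − (r−1) ≥ 2` (simple, nonzero, pairwise non-isogenous abelian varieties
`X_ν`, `n_ν ≥ 1`), then for some `ν₀` and some CM point `θ` (`End(E_θ) ≠ ℤ`):
all `X_ν` are elliptic curves, `X_ν ≁ E_θ` for `ν ≠ ν₀`, and
`∏_ν X_ν^{n_ν} ∼ E_θ^{g−(r−1)} × ∏_{ν ≠ ν₀} X_ν` ("where `E` is a CM elliptic curve not isogenous to any of
the `E_i`'s, and `E_i` and `E_j` are not isogenous for `i ≠ j`").
[cite: HulekLaface2019PicardNumbersAV, §3.1 Cor. 3.2] -/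
theorem exists_isIsogenous_cm_ellipticPow_prod_of_finrank_neronSeveriGroup_eq [Nonempty ρ]
    (hX : ∀ ν, IsSimple (X ν)) (hA : ∀ ν, IsAbelianVariety (X ν))
    (hXX : ∀ ν ν', ν ≠ ν' → ¬ IsIsogenous (X ν) (X ν')) (hn : ∀ ν, 0 < n ν)
    (h2 : 2 ≤ ∑ ν, n ν * finrank ℂ (G ν) - (Fintype.card ρ - 1))
    (hmax : finrank ℤ (neronSeveriGroup (sigmaPiPeriod fun ν ↦ powPeriod (X ν) (n ν))) =
      (∑ ν, n ν * finrank ℂ (G ν) - (Fintype.card ρ - 1)) ^ 2 + (Fintype.card ρ - 1)) :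
    ∃ (ν₀ : ρ) (θ : ℂ) (hθ : θ.im ≠ 0), ellipticEnd hθ ≠ ⊥ ∧ (∀ ν, finrank ℂ (G ν) = 1) ∧
      IsIsogenous (X ν₀) (ellipticPeriod hθ) ∧ (∀ ν, ν ≠ ν₀ → ¬ IsIsogenous (X ν) (ellipticPeriod hθ)) ∧
      IsIsogenous (sigmaPiPeriod fun ν ↦ powPeriod (X ν) (n ν))
        (prodPeriod (powPeriod (ellipticPeriod hθ) (∑ ν, n ν * finrank ℂ (G ν) - (Fintype.card ρ - 1)))
          (sigmaPiPeriod fun ν : {ν // ν ≠ ν₀} ↦ X ν.1)) := by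
  obtain ⟨ν₀, hdim, hn1, hcm⟩ := (finrank_neronSeveriGroup_powers_eq_iff X n hX hA hXX hn).1 hmax
  -- the exponent of the distinguished factor
  set k : ρ → ℕ := fun ν ↦ n ν * finrank ℂ (G ν) with hk
  have hkν : ∀ ν, ν ≠ ν₀ → k ν = 1 := fun ν hν ↦ by rw [hk]; simp only [hn1 ν hν, hdim ν]
  obtain ⟨hs1, -⟩ := sum_eq_add_card_sub_one_of_forall_ne k hkν
  have hm : ∑ ν, n ν * finrank ℂ (G ν) - (Fintype.card ρ - 1) = n ν₀ := by
    change ∑ ν, k ν - (Fintype.card ρ - 1) = n ν₀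
    rw [hs1, Nat.add_sub_cancel, hk]
    simp only [hdim ν₀, mul_one]
  rw [hm] at h2 ⊢
  -- `X_{ν₀}` is a CM elliptic curve `E_θ`
  obtain ⟨θ, hθ, hXE⟩ := exists_isIsomorphic_ellipticPeriod (X ν₀) (hdim ν₀)
  have hcmθ : ellipticEnd hθ ≠ ⊥ := by
    rw [← finrank_endAlgRat_ellipticPeriod_eq_two_iff, ← hXE.isIsogenous.finrank_endAlgRat_eq]
    exact hcm h2
  refine ⟨ν₀, θ, hθ, hcmθ, hdim, hXE.isIsogenous, fun ν hν hνE ↦ hXX ν ν₀ hν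
    (IsIsogenous.trans _ _ _ hνE (IsIsogenous.symm _ _ hXE.isIsogenous)), ?_⟩
  -- split `∏_ν X_ν^{n_ν} ≅ (∏_{ν = ν₀} X_ν^{n_ν}) × (∏_{ν ≠ ν₀} X_ν^{n_ν})`
  let e : ρ ≃ {ν // ν = ν₀} ⊕ {ν // ν ≠ ν₀} := (Equiv.sumCompl fun ν ↦ ν = ν₀).symm
  have hsplit := isIsomorphic_sigmaPiPeriod_sumEquiv (fun ν ↦ powPeriod (X ν) (n ν)) e
  letI : Unique {ν // ν = ν₀} := ⟨⟨⟨ν₀, rfl⟩⟩, fun ν ↦ Subtype.ext ν.2⟩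
  -- first block: `X_{ν₀}^{n_{ν₀}} ∼ E_θ^{n_{ν₀}}`
  have h1 : IsIsogenous (sigmaPiPeriod fun i : {ν // ν = ν₀} ↦ powPeriod (X (e.symm (Sum.inl i))) (n (e.symm (Sum.inl i))))
      (powPeriod (ellipticPeriod hθ) (n ν₀)) :=
    IsIsogenous.trans _ _ _
      (isIsomorphic_sigmaPiPeriod_unique fun i : {ν // ν = ν₀} ↦
        powPeriod (X (e.symm (Sum.inl i))) (n (e.symm (Sum.inl i)))).isIsogenous
      (hXE.isIsogenous.pow _ _ (n := n ν₀))
  -- second block: `∏_{ν ≠ ν₀} X_ν^{1} ≅ ∏_{ν ≠ ν₀} X_ν`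
  have h2' : IsIsogenous (sigmaPiPeriod fun j : {ν // ν ≠ ν₀} ↦ powPeriod (X (e.symm (Sum.inr j))) (n (e.symm (Sum.inr j))))
      (sigmaPiPeriod fun ν : {ν // ν ≠ ν₀} ↦ X ν.1) :=
    IsIsogenous.sigmaPi _ _ fun j ↦ by
      change IsIsogenous (powPeriod (X j.1) (n j.1)) (X j.1)
      rw [hn1 j.1 j.2]
      exact (isIsomorphic_powPeriod_one (X j.1)).symm.isIsogenous
  exact IsIsogenous.trans _ _ _ hsplit.isIsogenous (h1.prod h2')

end CorThreeTwo

/-! ## §8 Thm. 1.1 (1) for every abelian variety outside Murty's case `A ∼ Bᵏ`, `dim B ≥ 2` -/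

section FirstGap

variable {ι : Type*} [Fintype ι] [DecidableEq ι] {E : Type*} [NormedAddCommGroup E] [NormedSpace ℂ E]
  {ρ : Type*} [Fintype ρ] [DecidableEq ρ] {τ : ρ → Type*} [∀ ν, Fintype (τ ν)] [∀ ν, DecidableEq (τ ν)]
  [∀ ν, Nonempty (τ ν)]
  {G : ρ → Type*} [∀ ν, NormedAddCommGroup (G ν)] [∀ ν, NormedSpace ℂ (G ν)]
  (X : ∀ ν, (τ ν → ℝ) ≃L[ℝ] G ν) (n : ρ → ℕ)

/-- **Hulek–Laface 2019, Thm. 1.1 (1) for every abelian variety of dimension `g ≥ 4` whose Poincaré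
decomposition is not a power `Bᵏ` of ONE simple abelian variety `B` of dimension `≥ 2`**: then
`ρ(A) = g²` or `ρ(A) ≤ (g−1)² + 1`. Case (a) `r(A) ≥ 2` is
`IsIsogenous.finrank_neronSeveriGroup_le_sq_pred_add_one_of_two_le_card` (Prop. 3.1); case (b) with
`m = dim B = 1`: `A ∼ E_θ^g` has `ρ = g²` (CM) or `ρ = C(g+1, 2) ≤ (g−1)² + 1` (no CM; Lange 2023 §7.3.3
Exercise (3), `IsIsogenous.finrank_neronSeveriGroup_eq_choose_of_forall_ne`). The remaining case (b),
`m ≥ 2`, `k ≤ g/2`, rests on Murty's `ρ(Bᵏ)` by Albert type (Prop. 2.4 / Cor. 2.5) and is NOT covered here.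
-- TODO(general form): Murty 1984 Lemma 3.3 (`ρ(Bᵏ)` for a simple abelian variety `B` by Albert type).
[cite: HulekLaface2019PicardNumbersAV, Thm. 1.1 (1) and §3.2 (cases (a), (b))] -/
theorem IsIsogenous.finrank_neronSeveriGroup_eq_sq_or_le_of_powers {A : (ι → ℝ) ≃L[ℝ] E}
    (hiso : IsIsogenous A (sigmaPiPeriod fun ν ↦ powPeriod (X ν) (n ν))) (hX : ∀ ν, IsSimple (X ν))
    (hA : ∀ ν, IsAbelianVariety (X ν)) (hXX : ∀ ν ν', ν ≠ ν' → ¬ IsIsogenous (X ν) (X ν'))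
    (hn : ∀ ν, 0 < n ν) (hg : 4 ≤ finrank ℂ E) (hMurty : Fintype.card ρ = 1 → ∀ ν, finrank ℂ (G ν) = 1) :
    finrank ℤ (neronSeveriGroup A) = finrank ℂ E ^ 2 ∨
      finrank ℤ (neronSeveriGroup A) ≤ (finrank ℂ E - 1) ^ 2 + 1 := by
  haveI : ∀ ν, FiniteDimensional ℂ (G ν) := fun ν ↦ finiteDimensional_complex_of_period (X ν)
  rcases Nat.lt_or_ge (Fintype.card ρ) 2 with h1 | h2
  · -- `r(A) = 1`: by `hMurty` the simple factor is an elliptic curve, `A ∼ E_θ^g`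
    have hcard : Fintype.card ρ = 1 := by
      rcases Nat.lt_or_ge (Fintype.card ρ) 1 with h0 | h0
      · exfalso
        haveI : IsEmpty ρ := Fintype.card_eq_zero_iff.1 (by omega)
        have hE : finrank ℂ E = 0 := by
          rw [hiso.finrank_eq _ _, finrank_powers_eq X n, Finset.univ_eq_empty, Finset.sum_empty]
        omega
      · omega
    obtain ⟨ν₀, huniq⟩ := Fintype.card_eq_one_iff.1 hcard
    letI : Unique ρ := { default := ν₀, uniq := huniq }
    obtain ⟨θ, hθ, hXE⟩ := exists_isIsomorphic_ellipticPeriod (X ν₀) (hMurty hcard ν₀)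
    have hAE : IsIsogenous A (powPeriod (ellipticPeriod hθ) (n ν₀)) :=
      IsIsogenous.trans _ _ _ hiso (IsIsogenous.trans _ _ _
        (isIsomorphic_sigmaPiPeriod_unique fun ν ↦ powPeriod (X ν) (n ν)).isIsogenous
        (hXE.isIsogenous.pow _ _ (n ν₀)))
    have hng : finrank ℂ E = n ν₀ := by
      rw [hAE.finrank_eq _ _, finrank_fin_fun, Module.finrank_self, mul_one]
    rw [hng] at hg ⊢
    by_cases hCM : ∃ a b : ℚ, θ ^ 2 + a * θ + b = 0
    · refine Or.inl ?_
      rw [hAE.finrank_neronSeveriGroup_eq _ _]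
      exact (finrank_neronSeveriGroup_pow_eq_sq_iff_of_finrank_eq_one (ellipticPeriod hθ) (n := n ν₀) (by omega)
        (Module.finrank_self ℂ)).2
        ((finrank_endAlgRat_ellipticPeriod_eq_two_iff hθ).2 ((ComplexTorus.ellipticEnd_ne_bot_iff hθ).2 hCM))
    · push Not at hCM
      refine Or.inr ?_
      rw [hAE.finrank_neronSeveriGroup_eq_choose_of_forall_ne _ hθ (n ν₀) hCM]
      exact choose_succ_two_le_sq_pred_add_one hg
  · exact Or.inr (hiso.finrank_neronSeveriGroup_le_sq_pred_add_one_of_two_le_card X n hX hA hXX hn h2)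

/-- **Thm. 1.1 (1) in the printed form, outside Murty's case: "there does not exist any abelian variety
of dimension `g` (`g ≥ 4`) with Picard number `ρ` in the range `(g−1)² + 1 < ρ < g²`"** — for every `A`
whose Poincaré decomposition is not `Bᵏ` with `dim B ≥ 2`.
[cite: HulekLaface2019PicardNumbersAV, Thm. 1.1 (1)] -/
theorem IsIsogenous.not_lt_finrank_neronSeveriGroup_lt_of_powers {A : (ι → ℝ) ≃L[ℝ] E}
    (hiso : IsIsogenous A (sigmaPiPeriod fun ν ↦ powPeriod (X ν) (n ν))) (hX : ∀ ν, IsSimple (X ν))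
    (hA : ∀ ν, IsAbelianVariety (X ν)) (hXX : ∀ ν ν', ν ≠ ν' → ¬ IsIsogenous (X ν) (X ν'))
    (hn : ∀ ν, 0 < n ν) (hg : 4 ≤ finrank ℂ E) (hMurty : Fintype.card ρ = 1 → ∀ ν, finrank ℂ (G ν) = 1) :
    ¬ ((finrank ℂ E - 1) ^ 2 + 1 < finrank ℤ (neronSeveriGroup A) ∧
      finrank ℤ (neronSeveriGroup A) < finrank ℂ E ^ 2) := by
  rintro ⟨hlt, hlt'⟩
  rcases hiso.finrank_neronSeveriGroup_eq_sq_or_le_of_powers X n hX hA hXX hn hg hMurty with h | h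
  · exact absurd h hlt'.ne
  · exact absurd h (not_le.2 hlt)

end FirstGap

/-! ## §9 Validation: `ρ(E_{i√m}² × E_{i√m'}) = 5 = M_{2,3}` through Cor. 2.3 as printed -/

section Validation

/-- `6` is not a square. [folklore] -/
private theorem not_isSquare_six : ¬ IsSquare (2 * 3) := by
  rintro ⟨k, hk⟩
  have hk3 : k < 3 := by nlinarith
  interval_cases k <;> omega

/-- **Validation of Cor. 2.3 / Prop. 3.1 / Cor. 3.2 on `E_{i√m}² × E_{i√m'}`** (`g = 3`, `r = 2`; e.g.
`m = 2`, `m' = 3`): for `m m'` not a square the pair `X₀ = E_{i√m}` (a CM curve, `(i√m)² + m = 0`),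
`X₁ = E_{i√m'}` with exponents `n = (2, 1)` is a Poincaré decomposition (simple, non-isogenous factors), and
Cor. 2.3 computes `ρ = ρ(E_{i√m}²) + ρ(E_{i√m'}) = 2² + 1 = 5 = M_{2,3} = (3 − 1)² + 1` — the extremal value
of Prop. 3.1, in the shape predicted by Cor. 3.2.
[cite: HulekLaface2019PicardNumbersAV, §3.1 Prop. 3.1 ("This value is attained …"), Cor. 3.2 and §1 (`R_3 = {1, …, 6, 9}`)] -/
theorem finrank_neronSeveriGroup_ellipticSqrt_sq_prod_ellipticSqrt {m m' : ℕ} (hsq : ¬ IsSquare (m * m'))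
    (hτ : ∀ ν : Fin 2, ((![I * (Real.sqrt m : ℂ), I * (Real.sqrt m' : ℂ)] : Fin 2 → ℂ) ν).im ≠ 0) :
    finrank ℤ (neronSeveriGroup (sigmaPiPeriod fun ν : Fin 2 ↦
      powPeriod (ellipticPeriod (hτ ν)) ((![2, 1] : Fin 2 → ℕ) ν))) = 5 ∧ (3 - (2 - 1)) ^ 2 + (2 - 1) = 5 := by
  refine ⟨?_, by norm_num⟩
  -- the curves have positive imaginary part (`√m > 0` since `(i√m).im ≠ 0`)
  have hpos : ∀ ν : Fin 2, 0 < (((![I * (Real.sqrt m : ℂ), I * (Real.sqrt m' : ℂ)] : Fin 2 → ℂ) ν)).im := by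
    have him : ∀ a : ℕ, (I * (Real.sqrt a : ℂ)).im = Real.sqrt a := fun a ↦ by simp
    intro ν
    have hne := hτ ν
    fin_cases ν
    · change (I * (Real.sqrt m : ℂ)).im ≠ 0 at hne
      change 0 < (I * (Real.sqrt m : ℂ)).im
      rw [him] at hne ⊢
      exact lt_of_le_of_ne (Real.sqrt_nonneg _) (Ne.symm hne)
    · change (I * (Real.sqrt m' : ℂ)).im ≠ 0 at hne
      change 0 < (I * (Real.sqrt m' : ℂ)).im
      rw [him] at hne ⊢
      exact lt_of_le_of_ne (Real.sqrt_nonneg _) (Ne.symm hne)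
  rw [finrank_neronSeveriGroup_powers _ _ (fun ν ↦ isSimple_ellipticPeriod _)
    (fun ν ↦ by simpa using isAbelianVariety_elliptic (hpos ν)) ?_]
  · rw [Fin.sum_univ_two]
    -- `ρ(E_{i√m}²) = 4`: `E_{i√m}` has complex multiplication
    have hcm : ellipticEnd (hτ 0) ≠ ⊥ := by
      rw [ellipticEnd_ne_bot_iff]
      refine ⟨0, m, ?_⟩
      have hs : ((Real.sqrt m : ℝ) : ℂ) ^ 2 = (m : ℂ) := by
        rw [← Complex.ofReal_pow, Real.sq_sqrt (Nat.cast_nonneg m), Complex.ofReal_natCast]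
      show (I * (Real.sqrt m : ℂ)) ^ 2 + ((0 : ℚ) : ℂ) * (I * (Real.sqrt m : ℂ)) + ((m : ℚ) : ℂ) = 0
      rw [mul_pow, Complex.I_sq, hs]
      push_cast
      ring
    have h0 : finrank ℤ (neronSeveriGroup (powPeriod (ellipticPeriod (hτ 0)) 2)) = 4 :=
      (finrank_neronSeveriGroup_pow_eq_sq_iff_of_finrank_eq_one (ellipticPeriod (hτ 0)) (n := 2) le_rfl
        (Module.finrank_self ℂ)).2 ((finrank_endAlgRat_ellipticPeriod_eq_two_iff _).2 hcm)
    -- `ρ(E_{i√m'}¹) = 1`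
    have h1 : finrank ℤ (neronSeveriGroup (powPeriod (ellipticPeriod (hτ 1)) 1)) = 1 :=
      finrank_neronSeveriGroup_eq_one_of_finrank_eq_one _
        (by rw [finrank_fin_fun, Module.finrank_self, mul_one])
    exact show finrank ℤ (neronSeveriGroup (powPeriod (ellipticPeriod (hτ 0)) 2)) +
        finrank ℤ (neronSeveriGroup (powPeriod (ellipticPeriod (hτ 1)) 1)) = 5 by rw [h0, h1]
  · -- `E_{i√m} ≁ E_{i√m'}`
    have hni : ¬ IsIsogenous (ellipticPeriod (hτ 0)) (ellipticPeriod (hτ 1)) :=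
      not_isIsogenous_ellipticPeriod_I_mul_sqrt hsq (hτ 0) (hτ 1)
    intro ν ν' hνν'
    fin_cases ν <;> fin_cases ν'
    · exact absurd rfl hνν'
    · exact hni
    · exact fun h ↦ hni (IsIsogenous.symm _ _ h)
    · exact absurd rfl hνν'

/-- The instance `m = 2`, `m' = 3`: **`ρ(E_{i√2}² × E_{i√3}) = 5 = M_{2,3}`**.
[cite: HulekLaface2019PicardNumbersAV, §3.1 Prop. 3.1 and Cor. 3.2] -/
theorem finrank_neronSeveriGroup_ellipticSqrtTwo_sq_prod_ellipticSqrtThree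
    (hτ : ∀ ν : Fin 2, ((![I * (Real.sqrt (2 : ℕ) : ℂ), I * (Real.sqrt (3 : ℕ) : ℂ)] : Fin 2 → ℂ) ν).im ≠ 0) :
    finrank ℤ (neronSeveriGroup (sigmaPiPeriod fun ν : Fin 2 ↦
      powPeriod (ellipticPeriod (hτ ν)) ((![2, 1] : Fin 2 → ℕ) ν))) = 5 :=
  (finrank_neronSeveriGroup_ellipticSqrt_sq_prod_ellipticSqrt not_isSquare_six hτ).1

end Validation

/-! ## §10 The factors of a Poincaré decomposition of an abelian variety are abelian varieties -/

section Factors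

variable {κ : Type*} [Fintype κ] [DecidableEq κ] {σ : κ → Type*} [∀ k, Fintype (σ k)]
  [∀ k, DecidableEq (σ k)] {F : κ → Type*} [∀ k, NormedAddCommGroup (F k)] [∀ k, NormedSpace ℂ (F k)]
  {Ψ : ∀ k, (σ k → ℝ) ≃L[ℝ] F k}

/-- **A factor of an abelian finite product torus is an abelian variety**: `∏_k X_k` abelian ⟹ each `X_k`
abelian (split `∏_k X_k ≅ X_{k₀} × ∏_{k ≠ k₀} X_k` and use "`X₁ × X₂` abelian ⇒ `X₁` abelian",
`IsAbelianVariety.of_prod_left`). [cite: SwinnertonDyer1974AbelianVarieties, Ch. II §7 Thm. 34 Cor. 1] [cite: Lange2023AbelianVarietiesComplex, §2.4.4 Thm. 2.4.25 ("with simple abelian varieties `X_ν`"), p. 123] -/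
theorem IsAbelianVariety.of_sigmaPi (h : IsAbelianVariety (sigmaPiPeriod Ψ)) (k₀ : κ) : IsAbelianVariety (Ψ k₀) := by
  let e : κ ≃ {k // k = k₀} ⊕ {k // k ≠ k₀} := (Equiv.sumCompl fun k ↦ k = k₀).symm
  have h1 := ((isIsomorphic_sigmaPiPeriod_sumEquiv Ψ e).isAbelianVariety_iff).1 h
  have h2 := IsAbelianVariety.of_prod_left _ _ h1
  letI : Unique {k // k = k₀} := ⟨⟨⟨k₀, rfl⟩⟩, fun k ↦ Subtype.ext k.2⟩
  exact ((isIsomorphic_sigmaPiPeriod_unique fun i : {k // k = k₀} ↦ Ψ (e.symm (Sum.inl i))).isAbelianVariety_iff).1 h2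

variable (Ψ) in
/-- **`∏_k X_k` is an abelian variety iff every factor is** (`IsAbelianVariety.sigmaPi` and Cor. 1).
[cite: SwinnertonDyer1974AbelianVarieties, Ch. II §7 Thm. 34 Cor. 1] [cite: Lange2023AbelianVarietiesComplex, §2.4.4 Thm. 2.4.25, p. 123] -/
theorem isAbelianVariety_sigmaPi_iff : IsAbelianVariety (sigmaPiPeriod Ψ) ↔ ∀ k, IsAbelianVariety (Ψ k) :=
  ⟨fun h k ↦ h.of_sigmaPi k, IsAbelianVariety.sigmaPi⟩

variable {ι : Type*} [Fintype ι] [DecidableEq ι] {E : Type*} [NormedAddCommGroup E] [NormedSpace ℂ E]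
  {Φ : (ι → ℝ) ≃L[ℝ] E}

/-- **`Xᵐ` abelian (`m ≥ 1`) ⟹ `X` abelian** (`Xᵐ ≅ X^{m−1} × X`). [cite: SwinnertonDyer1974AbelianVarieties, Ch. II §7 Thm. 34 Cor. 1] -/
theorem IsAbelianVariety.of_pow {m : ℕ} (hm : 0 < m) (h : IsAbelianVariety (powPeriod Φ m)) : IsAbelianVariety Φ := by
  obtain ⟨m', rfl⟩ : ∃ m', m = m' + 1 := ⟨m - 1, by omega⟩
  exact IsAbelianVariety.of_prod_right _ _ (((isIsomorphic_powPeriod_succ Φ m').isAbelianVariety_iff).1 h)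

variable (Φ) in
/-- `Xᵐ` (`m ≥ 1`) is an abelian variety iff `X` is. [cite: SwinnertonDyer1974AbelianVarieties, Ch. II §7 Thm. 34 Cor. 1] -/
theorem isAbelianVariety_powPeriod_iff {m : ℕ} (hm : 0 < m) : IsAbelianVariety (powPeriod Φ m) ↔ IsAbelianVariety Φ :=
  ⟨IsAbelianVariety.of_pow hm, fun h ↦ h.pow m⟩

variable {ρ : Type*} [Fintype ρ] [DecidableEq ρ] {τ : ρ → Type*} [∀ ν, Fintype (τ ν)] [∀ ν, DecidableEq (τ ν)]
  {G : ρ → Type*} [∀ ν, NormedAddCommGroup (G ν)] [∀ ν, NormedSpace ℂ (G ν)]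
  (X : ∀ ν, (τ ν → ℝ) ≃L[ℝ] G ν) (n : ρ → ℕ)

/-- **The factors `X_ν` of a Poincaré decomposition `A ∼ ∏_ν X_ν^{n_ν}` (`n_ν ≥ 1`) of an ABELIAN VARIETY
`A` are abelian varieties** (Prop. 2.1.1 (b): a torus isogenous to an abelian variety is abelian; then
§10's factor lemmas) — the hypothesis "`X_ν` abelian varieties" carried by Cor. 2.3 / Prop. 3.1 /
Cor. 3.2 above is automatic. [cite: Lange2023AbelianVarietiesComplex, §2.4.4 Thm. 2.4.25 ("with simple abelian varieties `X_ν`") and §2.1.1 Prop. 2.1.1 (b)] -/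
theorem IsAbelianVariety.of_isIsogenous_powers {A : (ι → ℝ) ≃L[ℝ] E} (hAV : IsAbelianVariety A)
    (hiso : IsIsogenous A (sigmaPiPeriod fun ν ↦ powPeriod (X ν) (n ν))) (hn : ∀ ν, 0 < n ν) (ν : ρ) :
    IsAbelianVariety (X ν) :=
  IsAbelianVariety.of_pow (hn ν) (((hiso.isAbelianVariety_iff).1 hAV).of_sigmaPi ν)

/-- **Prop. 3.1 for an abelian variety `A` with a Poincaré decomposition** (the factors' projectivity is
now derived): `ρ(A) ≤ [dim A − (r−1)]² + (r−1)`. [cite: HulekLaface2019PicardNumbersAV, §3.1 Prop. 3.1] -/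
theorem IsAbelianVariety.finrank_neronSeveriGroup_le_of_isIsogenous_powers [∀ ν, Nonempty (τ ν)]
    {A : (ι → ℝ) ≃L[ℝ] E} (hAV : IsAbelianVariety A)
    (hiso : IsIsogenous A (sigmaPiPeriod fun ν ↦ powPeriod (X ν) (n ν))) (hX : ∀ ν, IsSimple (X ν))
    (hXX : ∀ ν ν', ν ≠ ν' → ¬ IsIsogenous (X ν) (X ν')) (hn : ∀ ν, 0 < n ν) :
    finrank ℤ (neronSeveriGroup A) ≤ (finrank ℂ E - (Fintype.card ρ - 1)) ^ 2 + (Fintype.card ρ - 1) :=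
  hiso.finrank_neronSeveriGroup_le_of_powers X n hX (hAV.of_isIsogenous_powers X n hiso hn) hXX hn

end Factors

end ComplexTorus

end Literature.Geometry.Kaehler

end
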